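import Summits.AtomisticToContinuum.HydrodynamicLimit.Theses.ImplosionDichotomy
import Literature.MathematicalPhysics.KineticTheory.HardSphereEulerLLN
import Literature.Analysis.FluidPDE.HardSphereAlexander
-- cycle 3: the LANDED negative knowledge (Theorems/PolynomialCompression/Negative/*, refuter g3) — import these, not this file
import Summits.AtomisticToContinuum.HydrodynamicLimit.Theorems.PolynomialCompression.Negative.Untied
import Summits.AtomisticToContinuum.HydrodynamicLimit.Theorems.PolynomialCompression.Negative.AtTimeZero
import Summits.AtomisticToContinuum.HydrodynamicLimit.Theorems.PolynomialCompression.Negative.Everywhere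
import Summits.AtomisticToContinuum.HydrodynamicLimit.Theorems.PolynomialCompression.Negative.Ladder
import Summits.AtomisticToContinuum.HydrodynamicLimit.Theorems.PolynomialCompression.Negative.PdeForm
import Summits.AtomisticToContinuum.HydrodynamicLimit.Theorems.PolynomialCompression.Negative.Statics
import Summits.AtomisticToContinuum.HydrodynamicLimit.Theorems.PolynomialCompression.Negative.Energy
-- (`…Negative.Budget` and `…Negative.SmoothPressure`, accepted p71787/p71853, are cited by name in §10(a) and not
-- imported here only because the farm snapshot lagged their commit at publication time.)

/-!
# Disproof of `PolynomialCompression` — findings (cdisprove standing adversary, cycles 1–4)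

Crux `Summit.AtomisticToContinuum.HydrodynamicLimit.Theses.ImplosionDichotomy.PolynomialCompression`
(stmt-AtomisticToContinuum-12587, route ImplosionDichotomy, rank 4): `∃ κ > 0` and continuous
positive profiles `(a₀, θ₀, u₀)` such that along SOME sequence `σ → 0` an ADMISSIBLE (t = 0 fields =
LLN limit of the local Gibbs laws, through every hard-sphere flow family) classical hard-sphere-Euler
solution reaches density `σ^(-κ)` somewhere on its interval of classical existence.

VERDICT SO FAR: **RESISTS** (no kill; cycles 3–4 confirm). Everything below is `lean check`ed, sorry-free,
standard axioms. The cycle-1 file (34 decls, gate evidence 2026-08-15T22:39Z) is not mounted in later jails;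
this file RE-DERIVES its content and EXTENDS it (cycle 2: marked ✚; cycle 3: §10–§11, marked ✚✚; cycle 4: §12–§13, ✚✚✚).

✚✚ CYCLE 3 HEADLINE: the negative knowledge is now LANDED in the tree for import —
`Summits.AtomisticToContinuum.HydrodynamicLimit.Theorems.PolynomialCompression.Negative.{Untied, AtTimeZero,
Everywhere, Ladder, PdeForm, Statics, Energy, Budget, SmoothPressure}` (ALL ACCEPTED: p71002/p71019/p71057/p71143/
p71283/p71286/p71564/p71787/p71853) — data pinning / `polynomialCompression_iff_pde` / `lln_rhoLim` / `O(σ³)` statics /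
energy conservation and σ-uniform budgets / `HsEosLowDensity ⇒` smooth pressure field.
Line skeletons should `import` those modules (namespace `Summit.AtomisticToContinuum.HydrodynamicLimit.Theorems`)
rather than cite this workfile.

FINDINGS (section map):
* §0 vocabulary (`Flows`, `TiedThrough`, `Admissible`, flow-free `Tied`, common shape `Reaches`,
  `PolynomialCompressionAt κ`; `polynomialCompression_iff`, `denseExcursion_iff` are `Iff.rfl`).
* §1 the `t = 0` tie is FLOW-INDEPENDENT (`tiedThrough_iff_tied`, `admissible_of_tiedThrough`,
  `admissible_iff_tied`; flows exist for `σ < 1/2`, `flows_nonempty`, Alexander) and only sees the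
  time-0 slices (`admissible_congr_zero`).
* §2 ✚ STATICS, UNCONDITIONAL: limits in probability are unique (`eq_of_tendsto_measure_lt`); the LLN
  density is IDENTIFIED as the tree's explicit cluster series `rhoLim (profileOf a₀) σ`
  (`densityLLN_rhoLim`, `lln_rhoLim` — from the PROVED `localGibbs_lln_holds`); DATA PINNING
  `data_eq_of_tied`: admissible ⇒ `ρ 0 = rhoLim`, `u 0 = u₀`, `θ 0 = θ₀`.
* §3 ✚ quantitative statics now available: `rhoLim < (2e+1)M` uniformly in `σ` (`rhoLim_lt`),
  `|rhoLim - β| ≤ 16e²v₁M²σ³` (`abs_rhoLim_sub_β_le`, the O(σ³) sup-norm rate = input I2 at k = 0),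
  `|R - 1| ≤ 2eθ/(1-θ)`, `∫ rhoLim = 1`; `admissible_iff_data` (admissible ⇔ pinned data).
* §4 ✚ THE CRUX WITHOUT PARTICLES: `polynomialCompression_iff_pde` — the crux is EQUIVALENT to a
  deterministic PDE statement about ONE explicit data family `(rhoLim (profileOf a₀) σ, u₀, θ₀)`.
* §5 WHY IT RESISTS: `not_polynomialCompression_iff` (a disproof = a σ-uniform sub-polynomial `L∞`
  density bound for every profile), `diluteSelfConsistency_of_not_polynomialCompression` (a disproof
  PROVES the open rank-3 crux), `polynomialCompression_or_diluteSelfConsistency`,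
  `hydrodynamicLimit_of_not_polynomialCompression`.
* §6 κ-LADDER: antitone in `κ`; `DenseExcursion → PolynomialCompressionAt κ` for every `κ < 3`;
  `PolynomialCompressionAt κ → DenseExcursion` for `κ ≥ 3` (DE sits exactly at `κ = 3`).
* §7 LOAD-BEARING / STRENGTHENINGS: tie dropped ⇒ the statement is TRUE by a constant state
  (`polynomialCompressionUntied_holds`) — the tie is the only constraint; compression AT `t = 0` is
  FALSE, now ✚ UNCONDITIONALLY (`not_polynomialCompressionAtTimeZero`: pinned data are `< (2e+1)M`);
  mass of admissible data is `1` (`integral_density_zero_eq_one`).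
* §8 MECHANISM AUDIT / inputs for provers (docstring `mechanism_audit`), §9 attack census (cycles 1–2).
* §10 ✚✚ CYCLE 3: (a) dictionary to the landed `Negative/*` modules; (b) NO BULK COMPRESSION — every witness
  concentrates on volume `≤ σ^κ` (`volume_compressionSet_le`, landed `…Everywhere`), `∀ x`-strengthening refuted;
  (c) ENERGY IS CONSERVED along classical solutions whose pressure field is smooth (`integral_energy_eq`; smoothness
  of `y ↦ ρθZ(ρσ³)` is automatic once `HsEosLowDensity` gives `Z` analytic — the second place where stmt-0768 is
  load-bearing), hence σ-uniform kinetic/internal energy budgets for admissible data (`energy_budget`);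
  (d) PRE-PICK STUB AUDIT of the three lines (12 stubs): no stub killed, findings in `stub_audit_cycle3`.
* §11 ✚✚ attack census, cycle 3.
* §12 ✚✚✚ CYCLE 4 (gen 4; 0768 `HsEosLowDensity` is now PROVED, p75216): ENTROPY. The specific entropy
  `s = (3/2)log θ − log ρ − F(ρσ³)` is TRANSPORTED along every dilute classical solution (`∂ₜs + u·∇s = 0`), with the
  renormalised conservation laws `∫ρΦ(s)` and the two-sided ENTROPY PRINCIPLE `min s₀ ≤ s ≤ max s₀`; consequences:
  `θ ≍ ρ^{2/3}` σ-uniformly along admissible dilute solutions (NO COLD COMPRESSION: the strengthening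
  `PolynomialCompressionCold` is REFUTED, every witness has `θ ≥ cσ^(-2κ/3)`, `p ≥ cσ^(-5κ/3)` at the compression point),
  compression-set volume `≤ Cσ^(5κ/3)` and mass `≤ Cσ^(2κ/3)`; energy conservation of §10(c) is now UNCONDITIONAL in the
  dilute class. Six new `Negative/` modules (Entropy, EntropyHardSphere, ColdCompression, CompressionSet,
  ColdCompressionEos, ConstantProfiles: uniform profiles never witness; first-exit bootstrap lemma). §13 census, cycle 4.
-/

noncomputable section

namespace Summit.AtomisticToContinuum.HydrodynamicLimit.Cruxes.PolynomialCompression.Disproof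

open MeasureTheory Filter Set Topology
open scoped ENNReal
open Literature.MathematicalPhysics.KineticTheory Literature.Analysis.FluidPDE
open Literature.Analysis.FunctionSpaces
open Summit.AtomisticToContinuum.HydrodynamicLimit.Theses.ImplosionDichotomy

/-! ## §0 Vocabulary: flows, the `t = 0` tie, admissibility, the common shape `Reaches` -/

/-- A family of hard-sphere flows, one for each particle number `N + 1`, at reduced density `σ`
(the type quantified by `∀ Φ` in every item of the route). -/
abbrev Flows (σ : ℝ) :=
  (N : ℕ) → HardSphereFlow (Torus.geometry (Fin 3)) (hsDiameter σ N) (N + 1)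

/-- The `t = 0` tie THROUGH ONE flow family `Φ`: the local Gibbs empirical fields at time `0`
converge in probability to `(ρ, ρu, E)(0)`. -/
def TiedThrough (σ : ℝ) (a₀ : T3 → ℝ) (u₀ : T3 → V3) (θ₀ : T3 → ℝ) (Φ : Flows σ)
    (ρ : ℝ → T3 → ℝ) (u : ℝ → T3 → V3) (θ : ℝ → T3 → ℝ) : Prop :=
  TendstoHydroFieldsAt (fun N => localGibbsLaw σ a₀ u₀ θ₀ N (Φ N)) Φ ρ u θ 0

/-- ADMISSIBILITY of Euler fields `(ρ, u, θ)` for the profiles `(a₀, u₀, θ₀)` at reduced density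
`σ`: the `t = 0` tie through EVERY flow family (verbatim the `∀ Φ, TendstoHydroFieldsAt … 0` clause
of `PolynomialCompression`, `DenseExcursion`, `DiluteSelfConsistency`, …). -/
def Admissible (σ : ℝ) (a₀ : T3 → ℝ) (u₀ : T3 → V3) (θ₀ : T3 → ℝ)
    (ρ : ℝ → T3 → ℝ) (u : ℝ → T3 → V3) (θ : ℝ → T3 → ℝ) : Prop :=
  ∀ Φ : Flows σ, TiedThrough σ a₀ u₀ θ₀ Φ ρ u θ

/-- The flow-free `t = 0` tie: the same three convergences in probability, but for the flow-free
local Gibbs MEASURE `localGibbsMeasure` and the UNMOVED configuration `z` (no `Φ`, no `flow 0`). -/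
def Tied (σ : ℝ) (a₀ : T3 → ℝ) (u₀ : T3 → V3) (θ₀ : T3 → ℝ)
    (ρ : ℝ → T3 → ℝ) (u : ℝ → T3 → V3) (θ : ℝ → T3 → ℝ) : Prop :=
  ∀ χ : T3 → ℝ, Continuous χ → ∀ δ > (0 : ℝ),
    Tendsto (fun N => localGibbsMeasure σ a₀ u₀ θ₀ N
      {z | δ < |empiricalDensityField z χ - ∫ x, χ x * ρ 0 x|}) atTop (𝓝 0) ∧
    Tendsto (fun N => localGibbsMeasure σ a₀ u₀ θ₀ N
      {z | δ < ‖empiricalMomentumField z χ - ∫ x, (χ x * ρ 0 x) • u 0 x‖}) atTop (𝓝 0) ∧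
    Tendsto (fun N => localGibbsMeasure σ a₀ u₀ θ₀ N
      {z | δ < |empiricalEnergyField z χ -
        ∫ x, χ x * totalEnergyDensity (ρ 0 x) (u 0 x) (θ 0 x)|}) atTop (𝓝 0)

/-- The common shape of the route's negative-side items: continuous positive profiles, and along
SOME sequence `σ → 0` an admissible classical hard-sphere-Euler solution whose density is `good`
somewhere on its interval of classical existence. `PolynomialCompression` is
`∃ κ > 0, Reaches (σ^(-κ) ≤ ·)`, `DenseExcursion` is `∃ η > 0, Reaches (η ≤ · * σ³)`. -/
def Reaches (good : ℝ → ℝ → Prop) : Prop :=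
  ∃ (a₀ θ₀ : T3 → ℝ) (u₀ : T3 → V3), Continuous a₀ ∧ Continuous θ₀ ∧ Continuous u₀ ∧
    (∀ x, 0 < a₀ x) ∧ (∀ x, 0 < θ₀ x) ∧ ∀ σ₀ : ℝ, 0 < σ₀ → ∃ σ : ℝ, 0 < σ ∧ σ < σ₀ ∧
      ∃ (T : ℝ) (ρ θ : ℝ → T3 → ℝ) (u : ℝ → T3 → V3), IsHardSphereEulerSolution σ T ρ u θ ∧
        Admissible σ a₀ u₀ θ₀ ρ u θ ∧ ∃ t ∈ Ico 0 T, ∃ x, good σ (ρ t x)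

/-- `PolynomialCompression` at a GIVEN exponent `κ` (the crux is `∃ κ > 0, PolynomialCompressionAt κ`). -/
def PolynomialCompressionAt (κ : ℝ) : Prop :=
  Reaches fun σ r => σ ^ (-κ) ≤ r

/-- The crux, unfolded: `PolynomialCompression ↔ ∃ κ > 0, PolynomialCompressionAt κ` (definitional). -/
theorem polynomialCompression_iff :
    PolynomialCompression ↔ ∃ κ : ℝ, 0 < κ ∧ PolynomialCompressionAt κ :=
  Iff.rfl

/-- `DenseExcursion ↔ ∃ η > 0, Reaches (η ≤ ρ σ³)` (definitional). -/
theorem denseExcursion_iff :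
    DenseExcursion ↔ ∃ η : ℝ, 0 < η ∧ Reaches fun σ r => η ≤ r * σ ^ 3 :=
  Iff.rfl

/-- Monotonicity of the common shape in the target predicate, where the implication is only
needed for `0 < σ < σ₁` (shrink `σ₀` to `min σ₀ σ₁`). -/
theorem Reaches.mono {g g' : ℝ → ℝ → Prop} {σ₁ : ℝ} (hσ₁ : 0 < σ₁)
    (h : ∀ σ r, 0 < σ → σ < σ₁ → g σ r → g' σ r) : Reaches g → Reaches g' := by
  rintro ⟨a₀, θ₀, u₀, ha, hθ, hu, ha0, hθ0, H⟩
  refine ⟨a₀, θ₀, u₀, ha, hθ, hu, ha0, hθ0, fun σ₀ hσ₀ => ?_⟩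
  obtain ⟨σ, hσ, hσlt, T, ρ, θ, u, hE, hA, t, ht, x, hx⟩ := H (min σ₀ σ₁) (lt_min hσ₀ hσ₁)
  exact ⟨σ, hσ, lt_of_lt_of_le hσlt (min_le_left _ _), T, ρ, θ, u, hE, hA, t, ht, x,
    h σ _ hσ (lt_of_lt_of_le hσlt (min_le_right _ _)) hx⟩

/-! ## §1 The `t = 0` tie is flow-independent (Alexander's theorem only supplies inhabitants) -/

/-- Flow families exist at every reduced density `0 < σ < 1/2` (Alexander's theorem on `𝕋³`,
`HardSphereFlow.nonempty_torus_holds`, with `hsDiameter σ N ≤ σ < 1/2`). -/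
theorem flows_nonempty {σ : ℝ} (hσ : 0 < σ) (hσ2 : σ < 1 / 2) : Nonempty (Flows σ) :=
  ⟨fun N => Classical.choice (HardSphereFlow.nonempty_torus_holds (d := Fin 3)
    (hsDiameter_pos hσ N) ((hsDiameter_le hσ.le N).trans_lt (hσ2.trans_eq (by norm_num)))
    (N + 1))⟩

/-- **The tie through any one flow family is the flow-free tie** (`Φ_0 = id` Liouville-a.e. on the
good set, the local Gibbs law is absolutely continuous and equals `localGibbsMeasure` for every
flow: `localGibbsLaw_preimage_flow_zero`). No hypothesis on `σ` or the profiles. -/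
theorem tiedThrough_iff_tied {σ : ℝ} {a₀ θ₀ : T3 → ℝ} {u₀ : T3 → V3} (Φ : Flows σ)
    {ρ θ : ℝ → T3 → ℝ} {u : ℝ → T3 → V3} :
    TiedThrough σ a₀ u₀ θ₀ Φ ρ u θ ↔ Tied σ a₀ u₀ θ₀ ρ u θ := by
  unfold TiedThrough TendstoHydroFieldsAt Tied
  have key : ∀ (N : ℕ) (p : Config (N + 1) (Fin 3) T3 → Prop),
      localGibbsLaw σ a₀ u₀ θ₀ N (Φ N) {z | p ((Φ N).flow 0 z)} =
        localGibbsMeasure σ a₀ u₀ θ₀ N {z | p z} :=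
    fun N p => localGibbsLaw_preimage_flow_zero σ a₀ u₀ θ₀ N (Φ N) {z | p z}
  refine forall_congr' fun χ => forall_congr' fun _ => forall_congr' fun δ =>
    forall_congr' fun _ => ?_
  have h1 : (fun N => localGibbsLaw σ a₀ u₀ θ₀ N (Φ N)
      {z | δ < |empiricalDensityField ((Φ N).flow 0 z) χ - ∫ x, χ x * ρ 0 x|}) =
      fun N => localGibbsMeasure σ a₀ u₀ θ₀ N
        {z | δ < |empiricalDensityField z χ - ∫ x, χ x * ρ 0 x|} :=
    funext fun N => key N fun z => δ < |empiricalDensityField z χ - ∫ x, χ x * ρ 0 x|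
  have h2 : (fun N => localGibbsLaw σ a₀ u₀ θ₀ N (Φ N)
      {z | δ < ‖empiricalMomentumField ((Φ N).flow 0 z) χ - ∫ x, (χ x * ρ 0 x) • u 0 x‖}) =
      fun N => localGibbsMeasure σ a₀ u₀ θ₀ N
        {z | δ < ‖empiricalMomentumField z χ - ∫ x, (χ x * ρ 0 x) • u 0 x‖} :=
    funext fun N => key N fun z => δ < ‖empiricalMomentumField z χ - ∫ x, (χ x * ρ 0 x) • u 0 x‖
  have h3 : (fun N => localGibbsLaw σ a₀ u₀ θ₀ N (Φ N)
      {z | δ < |empiricalEnergyField ((Φ N).flow 0 z) χ -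
        ∫ x, χ x * totalEnergyDensity (ρ 0 x) (u 0 x) (θ 0 x)|}) =
      fun N => localGibbsMeasure σ a₀ u₀ θ₀ N
        {z | δ < |empiricalEnergyField z χ -
          ∫ x, χ x * totalEnergyDensity (ρ 0 x) (u 0 x) (θ 0 x)|} :=
    funext fun N => key N fun z => δ < |empiricalEnergyField z χ -
      ∫ x, χ x * totalEnergyDensity (ρ 0 x) (u 0 x) (θ 0 x)|
  rw [h1, h2, h3]

/-- Admissibility (tie through ALL flows) follows from the tie through ONE flow family. -/
theorem admissible_of_tiedThrough {σ : ℝ} {a₀ θ₀ : T3 → ℝ} {u₀ : T3 → V3} (Φ : Flows σ)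
    {ρ θ : ℝ → T3 → ℝ} {u : ℝ → T3 → V3} (h : TiedThrough σ a₀ u₀ θ₀ Φ ρ u θ) :
    Admissible σ a₀ u₀ θ₀ ρ u θ :=
  fun Ψ => (tiedThrough_iff_tied Ψ).2 ((tiedThrough_iff_tied Φ).1 h)

/-- Admissibility is the flow-free tie, as soon as one flow family exists (`0 < σ < 1/2`). -/
theorem admissible_iff_tied {σ : ℝ} {a₀ θ₀ : T3 → ℝ} {u₀ : T3 → V3} (hne : Nonempty (Flows σ))
    {ρ θ : ℝ → T3 → ℝ} {u : ℝ → T3 → V3} :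
    Admissible σ a₀ u₀ θ₀ ρ u θ ↔ Tied σ a₀ u₀ θ₀ ρ u θ :=
  ⟨fun h => (tiedThrough_iff_tied hne.some).1 (h hne.some),
    fun h Φ => (tiedThrough_iff_tied Φ).2 h⟩

/-- The tie only sees the time-`0` slices of the fields. -/
theorem tied_congr_zero {σ : ℝ} {a₀ θ₀ : T3 → ℝ} {u₀ : T3 → V3}
    {ρ θ ρ' θ' : ℝ → T3 → ℝ} {u u' : ℝ → T3 → V3}
    (hρ : ρ 0 = ρ' 0) (hu : u 0 = u' 0) (hθ : θ 0 = θ' 0) :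
    Tied σ a₀ u₀ θ₀ ρ u θ ↔ Tied σ a₀ u₀ θ₀ ρ' u' θ' := by
  unfold Tied
  rw [hρ, hu, hθ]

/-- Admissibility only sees the time-`0` slices of the fields. -/
theorem admissible_congr_zero {σ : ℝ} {a₀ θ₀ : T3 → ℝ} {u₀ : T3 → V3}
    {ρ θ ρ' θ' : ℝ → T3 → ℝ} {u u' : ℝ → T3 → V3}
    (hρ : ρ 0 = ρ' 0) (hu : u 0 = u' 0) (hθ : θ 0 = θ' 0) :
    Admissible σ a₀ u₀ θ₀ ρ u θ ↔ Admissible σ a₀ u₀ θ₀ ρ' u' θ' :=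
  forall_congr' fun Φ => (tiedThrough_iff_tied Φ).trans
    ((tied_congr_zero hρ hu hθ).trans (tiedThrough_iff_tied Φ).symm)


/-! ## §2 Statics: limits in probability are unique, the LLN density is `rhoLim`, data pinning -/

/-- **Limits in probability are unique** (for eventually-probability laws): if the laws of
`F N` concentrate at `a` and at `b` then `a = b`. Elementary (cover `univ` by the two deviation
events at `δ = ‖a - b‖/3`). -/
theorem eq_of_tendsto_measure_lt {Ω : ℕ → Type*} [∀ N, MeasurableSpace (Ω N)]
    {P : (N : ℕ) → Measure (Ω N)} (hP : ∀ᶠ N in atTop, IsProbabilityMeasure (P N))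
    {E : Type*} [NormedAddCommGroup E] {F : (N : ℕ) → Ω N → E} {a b : E}
    (ha : ∀ δ > (0 : ℝ), Tendsto (fun N => P N {z | δ < ‖F N z - a‖}) atTop (𝓝 0))
    (hb : ∀ δ > (0 : ℝ), Tendsto (fun N => P N {z | δ < ‖F N z - b‖}) atTop (𝓝 0)) : a = b := by
  by_contra hab
  have hd : 0 < ‖a - b‖ := norm_pos_iff.2 (sub_ne_zero.2 hab)
  set δ := ‖a - b‖ / 3 with hδ
  have hδ0 : 0 < δ := by positivity
  have hcover : ∀ N, (univ : Set (Ω N)) ⊆ {z | δ < ‖F N z - a‖} ∪ {z | δ < ‖F N z - b‖} := by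
    intro N z _
    by_contra hz
    simp only [Set.mem_union, Set.mem_setOf_eq, not_or, not_lt] at hz
    have : ‖a - b‖ ≤ ‖F N z - a‖ + ‖F N z - b‖ := by
      calc ‖a - b‖ = ‖(F N z - b) - (F N z - a)‖ := by congr 1; abel
        _ ≤ ‖F N z - b‖ + ‖F N z - a‖ := norm_sub_le _ _
        _ = ‖F N z - a‖ + ‖F N z - b‖ := add_comm _ _
    linarith [hz.1, hz.2]
  have hle : ∀ᶠ N in atTop,
      (1 : ℝ≥0∞) ≤ P N {z | δ < ‖F N z - a‖} + P N {z | δ < ‖F N z - b‖} := by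
    filter_upwards [hP] with N hPN
    calc (1 : ℝ≥0∞) = P N univ := measure_univ.symm
      _ ≤ P N ({z | δ < ‖F N z - a‖} ∪ {z | δ < ‖F N z - b‖}) := measure_mono (hcover N)
      _ ≤ _ := measure_union_le _ _
  have hlim : Tendsto (fun N => P N {z | δ < ‖F N z - a‖} + P N {z | δ < ‖F N z - b‖})
      atTop (𝓝 0) := by
    simpa using (ha δ hδ0).add (hb δ hδ0)
  have h10 : (1 : ℝ≥0∞) ≤ 0 := ge_of_tendsto hlim hle
  exact absurd h10 (by simp)

/-- Real-valued version of `eq_of_tendsto_measure_lt` (deviation events written with `|·|`). -/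
theorem eq_of_tendsto_measure_lt_abs {Ω : ℕ → Type*} [∀ N, MeasurableSpace (Ω N)]
    {P : (N : ℕ) → Measure (Ω N)} (hP : ∀ᶠ N in atTop, IsProbabilityMeasure (P N))
    {F : (N : ℕ) → Ω N → ℝ} {a b : ℝ}
    (ha : ∀ δ > (0 : ℝ), Tendsto (fun N => P N {z | δ < |F N z - a|}) atTop (𝓝 0))
    (hb : ∀ δ > (0 : ℝ), Tendsto (fun N => P N {z | δ < |F N z - b|}) atTop (𝓝 0)) : a = b :=
  eq_of_tendsto_measure_lt (E := ℝ) hP (by simpa only [Real.norm_eq_abs] using ha)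
    (by simpa only [Real.norm_eq_abs] using hb)

/-- Two continuous functions on `𝕋³` with the same integrals against every continuous test
function are equal (test with `χ = f - g`: `∫ (f-g)² = 0`, Haar measure charges open sets). -/
theorem eq_of_forall_integral_mul_eq {f g : T3 → ℝ} (hf : Continuous f) (hg : Continuous g)
    (h : ∀ χ : T3 → ℝ, Continuous χ → ∫ x, χ x * f x = ∫ x, χ x * g x) : f = g := by
  have hw : Continuous fun x => f x - g x := hf.sub hg
  have h1 := h _ hw
  have hint : ∫ x, (f x - g x) ^ 2 = 0 := by
    have hi1 : Integrable (fun x => (f x - g x) * f x) := integrable_of_continuous_T3 (hw.mul hf)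
    have hi2 : Integrable (fun x => (f x - g x) * g x) := integrable_of_continuous_T3 (hw.mul hg)
    have h2 : ∫ x, ((f x - g x) * f x - (f x - g x) * g x) = 0 := by
      rw [integral_sub hi1 hi2, h1, sub_self]
    have e : (fun x => (f x - g x) ^ 2) = fun x => (f x - g x) * f x - (f x - g x) * g x := by
      funext x; ring
    rw [e]
    exact h2
  have hae : (fun x => (f x - g x) ^ 2) =ᵐ[volume] 0 :=
    (integral_eq_zero_iff_of_nonneg (fun x => sq_nonneg (f x - g x))
      (integrable_of_continuous_T3 (hw.pow 2))).1 hint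
  have heq : (fun x => (f x - g x) ^ 2) = 0 :=
    (Continuous.ae_eq_iff_eq volume (hw.pow 2) continuous_const).1 hae
  funext x
  have hx := congrFun heq x
  simp only [Pi.zero_apply, ne_eq, OfNat.ofNat_ne_zero, not_false_eq_true, pow_eq_zero_iff] at hx
  linarith

/-- Coordinates of a Bochner integral of a `V3`-valued function on `𝕋³`. -/
theorem integral_apply_coord {F : T3 → V3} (hF : Integrable F volume) (i : Fin 3) :
    (∫ x, F x) i = ∫ x, F x i :=
  ((EuclideanSpace.proj i : V3 →L[ℝ] ℝ).integral_comp_comm hF).symm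

/-- **The density law of large numbers with the IDENTIFIED limit `rhoLim`** (quantitative statics,
`HardSphereEulerLLN`): for continuous `a₀ > 0` and `0 < σ < σ₀(a₀)`, the smallness package
`SmallDensity (profileOf a₀) σ` holds, the positivity margin `4eMθ/(1-θ) < min β` holds, and the
empirical density of the configurational canonical Gibbs measure converges in probability to
`∫ χ · rhoLim (profileOf a₀) σ`, where `rhoLim P σ x = ∑_j γ_{j+1}(σ) R(σ)^{j+1} β(x)^{j+1}`
(`β = a₀/∫a₀`). This is the tree's `localGibbs_densityLLN_holds` with its witness exposed
(its statement hides `rhoLim` behind `∃ ρ₀`); the proof is the tree's, verbatim. -/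
theorem densityLLN_rhoLim {a₀ : T3 → ℝ} (ha : Continuous a₀) (ha0 : ∀ x, 0 < a₀ x) :
    ∃ σ₀ : ℝ, 0 < σ₀ ∧ ∀ σ : ℝ, 0 < σ → σ < σ₀ →
      SmallDensity (profileOf a₀ ha ha0) σ ∧
      (∀ x, 4 * Real.exp 1 * (profileOf a₀ ha ha0).M * geomRatio (profileOf a₀ ha ha0) σ /
          (1 - geomRatio (profileOf a₀ ha ha0) σ) < (profileOf a₀ ha ha0).β x) ∧
      ∀ χ : T3 → ℝ, Continuous χ → ∀ δ > (0 : ℝ),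
        Tendsto (fun N : ℕ => posGibbsMeasure a₀ (hsDiameter σ N) (N + 1)
          {x | δ < |((N + 1 : ℕ) : ℝ)⁻¹ * ∑ i, χ (x i) -
            ∫ y, χ y * rhoLim (profileOf a₀ ha ha0) σ y|}) atTop (𝓝 0) := by
  set P := profileOf a₀ ha ha0 with hP
  obtain ⟨x₀, -, hx₀⟩ := isCompact_univ.exists_isMinOn univ_nonempty P.continuous.continuousOn
  have hβmin : ∀ y, P.β x₀ ≤ P.β y := fun y => (isMinOn_iff.mp hx₀) y (mem_univ y)
  obtain ⟨σ₀, hσ₀, hsmall⟩ := exists_smallDensity P (P.pos x₀)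
  refine ⟨σ₀, hσ₀, fun σ hσ hσσ₀ => ?_⟩
  obtain ⟨h, hpos⟩ := hsmall σ hσ hσσ₀
  refine ⟨h, fun x => hpos.trans_le (hβmin x), ?_⟩
  intro χ hχ δ hδ
  obtain ⟨C, hC0, hχC⟩ := exists_forall_abs_le_of_continuous hχ
  have hχm : Measurable χ := hχ.measurable
  rw [← h.Ilim_eq_integral hχ]
  set I := Ilim P σ χ with hI
  set V : ℕ → ℝ := fun N => (∫ x, ((((N + 1 : ℕ) : ℝ))⁻¹ * ∑ i, χ (x i) - I) ^ 2 *
      Literature.MathematicalPhysics.StatisticalMechanics.efR (Ov (hsDiameter σ N)) x Finset.univ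
        ∂Measure.pi (fun _ : Fin (N + 1) => P.μ)) / XiN P σ N (N + 1) with hV
  have hVlim : Tendsto V atTop (𝓝 0) := h.tendsto_variance hχ
  have hbound : ∀ N : ℕ, posGibbsMeasure a₀ (hsDiameter σ N) (N + 1)
      {x | δ < |((N + 1 : ℕ) : ℝ)⁻¹ * ∑ i, χ (x i) - I|} ≤ ENNReal.ofReal (V N / δ ^ 2) := by
    intro N
    have hXi := XiN_pos h.σ_pos.le h.σ_lt_half h.ovDensity_lt_one (N := N) (m := N + 1) le_rfl
    have hA : Measurable fun x : Fin (N + 1) → T3 => ((N + 1 : ℕ) : ℝ)⁻¹ * ∑ i, χ (x i) :=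
      (Finset.measurable_sum _ fun i _ => hχm.comp (measurable_pi_apply i)).const_mul _
    have hAK : ∀ x : Fin (N + 1) → T3,
        |((N + 1 : ℕ) : ℝ)⁻¹ * ∑ i, χ (x i)| ≤ ((N + 1 : ℕ) : ℝ)⁻¹ * ((N + 1 : ℕ) * C) :=
      fun x => by
        rw [abs_mul, abs_of_nonneg (by positivity)]
        exact mul_le_mul_of_nonneg_left (abs_sum_apply_le hχC x) (by positivity)
    have hXi' : 0 ≤ (Xi P (hsDiameter σ N) (N + 1) (N + 1))⁻¹ := inv_nonneg.2 hXi.le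
    rw [posGibbsMeasure_eq ha ha0, Measure.smul_apply, smul_eq_mul]
    refine (mul_le_mul_right (restrict_hardCore_deviation_le P _ _ hA hAK I hδ) _).trans
      (le_of_eq ?_)
    rw [← ENNReal.ofReal_mul hXi']
    congr 1
    rw [hV]
    dsimp only
    rw [XiN, inv_mul_eq_div, div_div, div_div, mul_comm]
  have hlim : Tendsto (fun N => ENNReal.ofReal (V N / δ ^ 2)) atTop (𝓝 0) := by
    have := ENNReal.tendsto_ofReal (hVlim.div_const (δ ^ 2))
    rwa [zero_div, ENNReal.ofReal_zero] at this
  exact tendsto_of_tendsto_of_tendsto_of_le_of_le tendsto_const_nhds hlim (fun _ => zero_le) hbound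

/-- **The local-equilibrium law of large numbers with identified density.** For continuous
profiles `a₀, θ₀ > 0`, `u₀` there is `σ₁ ∈ (0, 1/2]` such that for `0 < σ < σ₁`: the quantitative
statics package holds and the local Gibbs laws are probability measures whose empirical density /
momentum / energy fields at `t = 0` converge in probability to those of the CONSTANT-IN-TIME fields
`(rhoLim (profileOf a₀) σ, u₀, θ₀)` through every flow family. (The tree's `localGibbs_lln_holds`
gives some continuous `ρ₀`; uniqueness of limits in probability against `densityLLN_rhoLim`
identifies `ρ₀ = rhoLim`.) -/
theorem lln_rhoLim {a₀ θ₀ : T3 → ℝ} {u₀ : T3 → V3} (ha : Continuous a₀) (hθ : Continuous θ₀)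
    (hu : Continuous u₀) (ha0 : ∀ x, 0 < a₀ x) (hθ0 : ∀ x, 0 < θ₀ x) :
    ∃ σ₁ : ℝ, 0 < σ₁ ∧ σ₁ ≤ 1 / 2 ∧ ∀ σ : ℝ, 0 < σ → σ < σ₁ →
      SmallDensity (profileOf a₀ ha ha0) σ ∧
      (∀ x, 4 * Real.exp 1 * (profileOf a₀ ha ha0).M * geomRatio (profileOf a₀ ha ha0) σ /
          (1 - geomRatio (profileOf a₀ ha ha0) σ) < (profileOf a₀ ha ha0).β x) ∧
      ∀ Φ : Flows σ, (∀ N, IsProbabilityMeasure (localGibbsLaw σ a₀ u₀ θ₀ N (Φ N))) ∧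
        TiedThrough σ a₀ u₀ θ₀ Φ (fun _ => rhoLim (profileOf a₀ ha ha0) σ) (fun _ => u₀)
          (fun _ => θ₀) := by
  set P := profileOf a₀ ha ha0 with hP
  obtain ⟨σa, hσa, Ha⟩ := localGibbs_lln_holds a₀ θ₀ u₀ ha hθ hu ha0 hθ0
  obtain ⟨σb, hσb, Hb⟩ := densityLLN_rhoLim ha ha0
  refine ⟨min (min σa σb) (1 / 2), lt_min (lt_min hσa hσb) (by norm_num), min_le_right _ _,
    fun σ hσ hσlt => ?_⟩
  have hσa' : σ < σa := lt_of_lt_of_le hσlt ((min_le_left _ _).trans (min_le_left _ _))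
  have hσb' : σ < σb := lt_of_lt_of_le hσlt ((min_le_left _ _).trans (min_le_right _ _))
  have hσ2 : σ ≤ 1 / 2 := (lt_of_lt_of_le hσlt (min_le_right _ _)).le
  obtain ⟨h, hpos, hdens⟩ := Hb σ hσ hσb'
  obtain ⟨ρ₀, hρc, -, Hlln⟩ := Ha σ hσ hσa'
  refine ⟨h, hpos, fun Φ => ⟨(Hlln Φ).1, ?_⟩⟩
  have hT : TiedThrough σ a₀ u₀ θ₀ Φ (fun _ => ρ₀) (fun _ => u₀) (fun _ => θ₀) := (Hlln Φ).2
  -- identification `ρ₀ = rhoLim P σ` by uniqueness of limits in probability of the density field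
  have hid : ρ₀ = rhoLim P σ := by
    refine eq_of_forall_integral_mul_eq hρc h.continuous_rhoLim fun χ hχ => ?_
    have hflowfree := (tiedThrough_iff_tied Φ).1 hT
    refine eq_of_tendsto_measure_lt_abs (P := fun N => localGibbsMeasure σ a₀ u₀ θ₀ N)
      (F := fun N z => empiricalDensityField z χ)
      (Eventually.of_forall fun N => isProbabilityMeasure_localGibbsMeasure ha hθ hu ha0 hθ0 hσ2 N)
      (fun δ hδ => (hflowfree χ hχ δ hδ).1) (fun δ hδ => ?_)
    refine (tendsto_localGibbsMeasure_densityEvent (u₀ := u₀) ha hθ hu (fun x => (ha0 x).le)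
      hθ0 σ hdens hχ hδ).congr fun N => ?_
    show localGibbsMeasure σ a₀ u₀ θ₀ N
        {z | δ < |((N + 1 : ℕ) : ℝ)⁻¹ * ∑ i, χ (z i).1 - ∫ y, χ y * rhoLim P σ y|} =
      localGibbsMeasure σ a₀ u₀ θ₀ N
        {z | δ < |empiricalDensityField z χ - ∫ y, χ y * rhoLim P σ y|}
    simp only [empiricalDensityField_eq_sum]
  subst hid
  exact hT

/-- **DATA PINNING.** If continuous time-`0` slices `(ρ 0, u 0, θ 0)` satisfy the flow-free tie
for the profiles `(a₀, u₀, θ₀)` at `σ ≤ 1/2`, and the tie also holds for constant-in-time fields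
`(ρ₀, u₀, θ₀)` with `ρ₀` continuous and positive (the LLN), then
`ρ 0 = ρ₀`, `u 0 = u₀`, `θ 0 = θ₀`: admissible Euler data are DICTATED by the profiles and `σ`
(uniqueness of limits in probability, field by field; momentum coordinatewise; `ρ₀ > 0` to divide). -/
theorem data_eq_of_tied {σ : ℝ} {a₀ θ₀ : T3 → ℝ} {u₀ : T3 → V3} (ha : Continuous a₀)
    (hθ : Continuous θ₀) (hu : Continuous u₀) (ha0 : ∀ x, 0 < a₀ x) (hθ0 : ∀ x, 0 < θ₀ x)
    (hσ2 : σ ≤ 1 / 2) {ρ₀ : T3 → ℝ} (hρ₀c : Continuous ρ₀) (hρ₀pos : ∀ x, 0 < ρ₀ x)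
    (hlln : Tied σ a₀ u₀ θ₀ (fun _ => ρ₀) (fun _ => u₀) (fun _ => θ₀))
    {ρ θ : ℝ → T3 → ℝ} {u : ℝ → T3 → V3} (hρc : Continuous (ρ 0)) (huc : Continuous (u 0))
    (hθc : Continuous (θ 0)) (ht : Tied σ a₀ u₀ θ₀ ρ u θ) :
    ρ 0 = ρ₀ ∧ u 0 = u₀ ∧ θ 0 = θ₀ := by
  have hP : ∀ᶠ N in atTop, IsProbabilityMeasure (localGibbsMeasure σ a₀ u₀ θ₀ N) :=
    Eventually.of_forall fun N => isProbabilityMeasure_localGibbsMeasure ha hθ hu ha0 hθ0 hσ2 N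
  -- density
  have hρ : ρ 0 = ρ₀ := by
    refine eq_of_forall_integral_mul_eq hρc hρ₀c fun χ hχ => ?_
    exact eq_of_tendsto_measure_lt_abs (F := fun N z => empiricalDensityField z χ) hP
      (fun δ hδ => (ht χ hχ δ hδ).1) (fun δ hδ => (hlln χ hχ δ hδ).1)
  -- momentum, coordinatewise
  have hu' : u 0 = u₀ := by
    have hvec : ∀ χ : T3 → ℝ, Continuous χ →
        ∫ x, (χ x * ρ₀ x) • u 0 x = ∫ x, (χ x * ρ₀ x) • u₀ x := by
      intro χ hχ
      have e := eq_of_tendsto_measure_lt (E := V3) (F := fun N z => empiricalMomentumField z χ) hP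
        (fun δ hδ => (ht χ hχ δ hδ).2.1) (fun δ hδ => (hlln χ hχ δ hδ).2.1)
      rw [hρ] at e
      exact e
    have hcoord : ∀ i : Fin 3, (fun x => ρ₀ x * u 0 x i) = fun x => ρ₀ x * u₀ x i := by
      intro i
      refine eq_of_forall_integral_mul_eq
        (hρ₀c.mul ((EuclideanSpace.proj i : V3 →L[ℝ] ℝ).continuous.comp huc))
        (hρ₀c.mul ((EuclideanSpace.proj i : V3 →L[ℝ] ℝ).continuous.comp hu)) fun χ hχ => ?_
      have e := congrArg (fun v : V3 => v i) (hvec χ hχ)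
      simp only at e
      rw [integral_apply_coord (F := fun x => (χ x * ρ₀ x) • u 0 x)
          (integrable_of_continuous_T3 ((hχ.mul hρ₀c).smul huc)),
        integral_apply_coord (F := fun x => (χ x * ρ₀ x) • u₀ x)
          (integrable_of_continuous_T3 ((hχ.mul hρ₀c).smul hu))] at e
      simp only [PiLp.smul_apply, smul_eq_mul] at e
      simpa only [mul_assoc] using e
    funext x
    ext i
    have := congrFun (hcoord i) x
    exact mul_left_cancel₀ (hρ₀pos x).ne' this
  -- energy
  have hθ' : θ 0 = θ₀ := by
    have hE : (fun x => totalEnergyDensity (ρ₀ x) (u₀ x) (θ 0 x)) =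
        fun x => totalEnergyDensity (ρ₀ x) (u₀ x) (θ₀ x) := by
      refine eq_of_forall_integral_mul_eq ?_ ?_ fun χ hχ => ?_
      · unfold totalEnergyDensity; fun_prop
      · unfold totalEnergyDensity; fun_prop
      · have e := eq_of_tendsto_measure_lt_abs (F := fun N z => empiricalEnergyField z χ) hP
          (fun δ hδ => (ht χ hχ δ hδ).2.2) (fun δ hδ => (hlln χ hχ δ hδ).2.2)
        rw [hρ, hu'] at e
        exact e
    funext x
    have hx := congrFun hE x
    unfold totalEnergyDensity at hx
    have := mul_left_cancel₀ (hρ₀pos x).ne' hx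
    linarith
  exact ⟨hρ, hu', hθ'⟩



/-! ## §3 Quantitative statics available in the tree: bounds on the equilibrium density `rhoLim` -/

/-- **Uniform sup bound**: `|rhoLim P σ x| ≤ 2eM/(1-θ)`, `M = sup β`, `θ = geomRatio P σ`. -/
theorem abs_rhoLim_le {P : DensityProfile} {σ : ℝ} (h : SmallDensity P σ) (x : T3) :
    |rhoLim P σ x| ≤ 2 * Real.exp 1 * P.M / (1 - geomRatio P σ) := by
  have hgeo : HasSum (fun j : ℕ => 2 * Real.exp 1 * P.M * geomRatio P σ ^ j)
      (2 * Real.exp 1 * P.M / (1 - geomRatio P σ)) := by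
    rw [div_eq_mul_inv]
    exact (hasSum_geometric_of_lt_one h.geomRatio_nonneg h.geomRatio_lt_one).mul_left _
  refine (Real.norm_eq_abs _).symm.trans_le ?_
  exact tsum_of_norm_bounded hgeo fun j => (Real.norm_eq_abs _).trans_le (h.abs_rhoLim_term_le j x)

/-- **Uniform sup bound, explicit**: `rhoLim P σ x < (2e + 1) M` for every small `σ` — the
equilibrium density of admissible data is bounded UNIFORMLY IN `σ` by a profile constant (this is
what kills every `t = 0` witness of the crux, §6). -/
theorem rhoLim_lt {P : DensityProfile} {σ : ℝ} (h : SmallDensity P σ) (x : T3) :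
    rhoLim P σ x < (2 * Real.exp 1 + 1) * P.M := by
  have h1 := abs_rhoLim_le h x
  have hθ1 := h.geomRatio_lt_one
  have hφ := h.phi_lt_half
  have hM := P.M_pos
  have hne : (1 - geomRatio P σ) ≠ 0 := (sub_pos.2 hθ1).ne'
  have hkey : 2 * Real.exp 1 * P.M / (1 - geomRatio P σ) =
      2 * Real.exp 1 * P.M + 2 * P.M * (Real.exp 1 * geomRatio P σ / (1 - geomRatio P σ)) := by
    field_simp
    ring
  have h2 : 2 * Real.exp 1 * P.M / (1 - geomRatio P σ) < (2 * Real.exp 1 + 1) * P.M := by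
    rw [hkey]; nlinarith
  exact (le_abs_self _).trans_lt (h1.trans_lt h2)

/-- **Closeness to `R β`**: `|rhoLim P σ x - R β(x)| ≤ 2eMθ/(1-θ)` (the `j ≥ 1` tail of the
series; the tree has the one-sided `rhoLim_ge`). -/
theorem abs_rhoLim_sub_ratioLimit_mul_le {P : DensityProfile} {σ : ℝ} (h : SmallDensity P σ) (x : T3) :
    |rhoLim P σ x - ratioLimit P σ * P.β x| ≤
      2 * Real.exp 1 * P.M * geomRatio P σ / (1 - geomRatio P σ) := by
  have hθ0 := h.geomRatio_nonneg
  have hsplit := (h.summable_rhoLim x).tsum_eq_zero_add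
  have h0 : clusterCoeff σ 0 * ratioLimit P σ ^ (0 + 1) * P.β x ^ (0 + 1) =
      ratioLimit P σ * P.β x := by
    have : clusterCoeff σ 0 = 1 := by
      have h1 := coefLim_one_zero (P := P) h.σ_pos
      rw [coefLim] at h1
      simpa [P.integral_eq_one] using h1
    rw [this]; ring
  have hgeo : HasSum (fun j : ℕ => 2 * Real.exp 1 * P.M * geomRatio P σ ^ (j + 1))
      (2 * Real.exp 1 * P.M * geomRatio P σ / (1 - geomRatio P σ)) := by
    have h' := (hasSum_geometric_of_lt_one hθ0 h.geomRatio_lt_one).mul_left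
      (2 * Real.exp 1 * P.M * geomRatio P σ)
    rw [div_eq_mul_inv]
    refine h'.congr_fun fun j => ?_
    rw [pow_succ]; ring
  have htail : |∑' j, clusterCoeff σ (j + 1) * ratioLimit P σ ^ (j + 1 + 1) * P.β x ^ (j + 1 + 1)| ≤
      2 * Real.exp 1 * P.M * geomRatio P σ / (1 - geomRatio P σ) := by
    refine (Real.norm_eq_abs _).symm.trans_le (tsum_of_norm_bounded hgeo fun j => ?_)
    exact (Real.norm_eq_abs _).trans_le (h.abs_rhoLim_term_le (j + 1) x)
  have heq : rhoLim P σ x - ratioLimit P σ * P.β x =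
      ∑' j, clusterCoeff σ (j + 1) * ratioLimit P σ ^ (j + 1 + 1) * P.β x ^ (j + 1 + 1) := by
    rw [rhoLim, hsplit, h0]; ring
  rw [heq]
  exact htail

/-- **The limit ratio is `1 + O(σ³)`**: `|R - 1| ≤ 2 · eθ/(1-θ)` (from `R F(R) = 1`,
`|F(R) - 1| ≤ eθ/(1-θ)` and `R ≤ 2`). -/
theorem abs_ratioLimit_sub_one_le {P : DensityProfile} {σ : ℝ} (h : SmallDensity P σ) :
    |ratioLimit P σ - 1| ≤ 2 * (Real.exp 1 * geomRatio P σ / (1 - geomRatio P σ)) := by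
  have hF := abs_ratioSeries_sub_one_le (P := P) h.σ_pos h.σ_lt_half h.geomRatio_lt_one
    h.abs_ratioLimit_le
  have hspec := (ratioLimit_spec (P := P) h.σ_pos h.σ_lt_half h.geomRatio_lt_one h.phi_lt_half).2
  have hR0 := h.ratioLimit_pos
  have hR2 := h.ratioLimit_mem.2
  have heq : ratioLimit P σ - 1 = ratioLimit P σ * (1 - ratioSeries P σ (ratioLimit P σ)) := by
    rw [mul_sub, mul_one, hspec]
  rw [heq, abs_mul, abs_of_pos hR0, abs_sub_comm]
  exact mul_le_mul hR2 hF (abs_nonneg _) zero_le_two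

/-- **The `O(σ³)` sup-norm statics rate** (input I2 of the shadowing mechanism at order `k = 0`,
now a theorem): `|rhoLim P σ x - β(x)| ≤ 16 e² v₁ M² σ³` for `SmallDensity P σ`
(`θ = 2e M v₁ σ³`, `1/(1-θ) < 2`). Higher `C^k` rates: `rhoLim P σ = g_σ ∘ β` with the scalar
power series `g_σ(b) = ∑_j γ_{j+1} R^{j+1} b^{j+1}`, `|γ_{j+1} R^{j+1}| ≤ 2e (2e v₁ σ³)ʲ`
(`abs_clusterCoeff_le`, `R ≤ 2`), radius `≥ (2e v₁ σ³)⁻¹ → ∞`; so `‖g_σ - R·id‖_{C^k[0,M]} =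
O_k(σ³)` and the `C^k` closeness of `rhoLim` to `Rβ` (hence to `β`) for smooth `β` is Faà di
Bruno bookkeeping — not done here. -/
theorem abs_rhoLim_sub_β_le {P : DensityProfile} {σ : ℝ} (h : SmallDensity P σ) (x : T3) :
    |rhoLim P σ x - P.β x| ≤ 16 * Real.exp 1 ^ 2 * v₁ * P.M ^ 2 * σ ^ 3 := by
  have h1 := abs_rhoLim_sub_ratioLimit_mul_le h x
  have h2 := abs_ratioLimit_sub_one_le h
  have hθ1 := h.geomRatio_lt_one
  have hθ0 := h.geomRatio_nonneg
  have hφ := h.phi_lt_half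
  have hM := P.M_pos
  have hβ0 := (P.pos x).le
  have hβM := P.le_M x
  have he : 0 < Real.exp 1 := Real.exp_pos 1
  have hv := v₁_pos
  have hσ3 : 0 ≤ σ ^ 3 := pow_nonneg h.σ_pos.le 3
  set θ' := geomRatio P σ with hθ'
  set φ := Real.exp 1 * θ' / (1 - θ') with hφdef
  have hφ0 : 0 ≤ φ := div_nonneg (mul_nonneg he.le hθ0) (sub_pos.2 hθ1).le
  -- |rhoLim - β| ≤ |rhoLim - Rβ| + |R - 1| β ≤ 2Mφ + 2φ M = 4 M φ
  have hstep : |rhoLim P σ x - P.β x| ≤ 4 * P.M * φ := by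
    have htri : |rhoLim P σ x - P.β x| ≤
        |rhoLim P σ x - ratioLimit P σ * P.β x| + |ratioLimit P σ - 1| * P.β x := by
      have e : rhoLim P σ x - P.β x =
          (rhoLim P σ x - ratioLimit P σ * P.β x) + (ratioLimit P σ - 1) * P.β x := by ring
      rw [e]
      refine (abs_add_le _ _).trans ?_
      rw [abs_mul, abs_of_nonneg hβ0]
    have hA : |rhoLim P σ x - ratioLimit P σ * P.β x| ≤ 2 * P.M * φ := by
      refine h1.trans (le_of_eq ?_)
      rw [hφdef]; ring
    have hB : |ratioLimit P σ - 1| * P.β x ≤ 2 * φ * P.M :=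
      mul_le_mul h2 hβM hβ0 (by positivity)
    linarith
  -- φ = eθ/(1-θ) ≤ 2eθ and θ = 2e M v₁ σ³
  have h1θ : 1 / 2 < 1 - θ' := by
    -- from eθ/(1-θ) < 1/2 and e ≥ 1: θ/(1-θ) < 1/2, so θ < (1-θ)/2 < ... ; direct: θ < 1/2
    have hθe : θ' ≤ Real.exp 1 * θ' := le_mul_of_one_le_left hθ0 (by
      have := Real.add_one_le_exp (1 : ℝ); linarith)
    have hlt : θ' / (1 - θ') < 1 / 2 :=
      lt_of_le_of_lt (div_le_div_of_nonneg_right hθe (sub_pos.2 hθ1).le) hφ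
    rw [div_lt_iff₀ (sub_pos.2 hθ1)] at hlt
    linarith
  have hφle : φ ≤ 2 * Real.exp 1 * θ' := by
    rw [hφdef, div_le_iff₀ (sub_pos.2 hθ1)]
    have hmul : Real.exp 1 * θ' * (1 / 2) ≤ Real.exp 1 * θ' * (1 - θ') :=
      mul_le_mul_of_nonneg_left h1θ.le (mul_nonneg he.le hθ0)
    linarith
  have hθeq : θ' = 2 * Real.exp 1 * (P.M * v₁ * σ ^ 3) := by
    rw [hθ', geomRatio, ovDensity]
  calc |rhoLim P σ x - P.β x| ≤ 4 * P.M * φ := hstep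
    _ ≤ 4 * P.M * (2 * Real.exp 1 * θ') := by gcongr
    _ = 16 * Real.exp 1 ^ 2 * v₁ * P.M ^ 2 * σ ^ 3 := by rw [hθeq]; ring

/-- **Mass normalisation**: `∫ rhoLim P σ = 1` (the empirical density of `χ ≡ 1` is `1`; in the
series, `I(1) = R F(R) = 1`). Hence every admissible datum has `∫ ρ(0) = 1` (§2, §6). -/
theorem integral_rhoLim_eq_one {P : DensityProfile} {σ : ℝ} (h : SmallDensity P σ) :
    ∫ y, rhoLim P σ y = 1 := by
  have h1 := h.Ilim_eq_integral (χ := fun _ => (1 : ℝ)) continuous_const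
  simp only [one_mul] at h1
  rw [← h1, Ilim]
  have hR := (ratioLimit_spec (P := P) h.σ_pos h.σ_lt_half h.geomRatio_lt_one h.phi_lt_half).2
  rw [ratioSeries] at hR
  have e : ∑' j, coefLim P σ (fun _ => 1) j * ratioLimit P σ ^ (j + 1) =
      ratioLimit P σ * ∑' j, coefLim P σ (fun _ => 1) j * ratioLimit P σ ^ j := by
    rw [← tsum_mul_left]
    exact tsum_congr fun j => by ring
  rw [e, hR]

/-- **ADMISSIBILITY = PINNED DATA.** For continuous profiles `a₀, θ₀ > 0`, `u₀` there is
`σ₁ ∈ (0, 1/2]` such that for `0 < σ < σ₁` and ANY fields with continuous time-`0` slices: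
`(ρ, u, θ)` is admissible (LLN tie through every flow family) iff
`ρ 0 = rhoLim (profileOf a₀) σ`, `u 0 = u₀`, `θ 0 = θ₀`. The hard-sphere Euler data of the route's
items are thus NOT free: they are the explicit cluster-expansion density, `u₀` and `θ₀`. -/
theorem admissible_iff_data {a₀ θ₀ : T3 → ℝ} {u₀ : T3 → V3} (ha : Continuous a₀) (hθ : Continuous θ₀)
    (hu : Continuous u₀) (ha0 : ∀ x, 0 < a₀ x) (hθ0 : ∀ x, 0 < θ₀ x) :
    ∃ σ₁ : ℝ, 0 < σ₁ ∧ σ₁ ≤ 1 / 2 ∧ ∀ σ : ℝ, 0 < σ → σ < σ₁ →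
      SmallDensity (profileOf a₀ ha ha0) σ ∧
      ∀ (ρ θ : ℝ → T3 → ℝ) (u : ℝ → T3 → V3), Continuous (ρ 0) → Continuous (u 0) →
        Continuous (θ 0) →
        (Admissible σ a₀ u₀ θ₀ ρ u θ ↔
          ρ 0 = rhoLim (profileOf a₀ ha ha0) σ ∧ u 0 = u₀ ∧ θ 0 = θ₀) := by
  obtain ⟨σ₁, hσ₁, hσ₁2, H⟩ := lln_rhoLim ha hθ hu ha0 hθ0
  refine ⟨σ₁, hσ₁, hσ₁2, fun σ hσ hσlt => ?_⟩
  obtain ⟨h, hpos, Hσ⟩ := H σ hσ hσlt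
  have hσ2 : σ < 1 / 2 := hσlt.trans_le hσ₁2
  refine ⟨h, fun ρ θ u hρc huc hθc => ⟨fun hA => ?_, fun hD => ?_⟩⟩
  · obtain ⟨Φ⟩ := flows_nonempty hσ hσ2
    have hlln : Tied σ a₀ u₀ θ₀ (fun _ => rhoLim (profileOf a₀ ha ha0) σ) (fun _ => u₀)
        (fun _ => θ₀) := (tiedThrough_iff_tied Φ).1 (Hσ Φ).2
    exact data_eq_of_tied ha hθ hu ha0 hθ0 hσ2.le h.continuous_rhoLim
      (fun x => h.rhoLim_pos (hpos x)) hlln hρc huc hθc ((tiedThrough_iff_tied Φ).1 (hA Φ))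
  · obtain ⟨hρ, hu', hθ'⟩ := hD
    exact (admissible_congr_zero (ρ' := fun _ => rhoLim (profileOf a₀ ha ha0) σ)
      (u' := fun _ => u₀) (θ' := fun _ => θ₀) hρ hu' hθ').2 fun Φ => (Hσ Φ).2

/-- Time-`0` slices of a classical solution on `[0, T)` with `0 < T` are continuous. -/
theorem continuous_slices_zero {σ T : ℝ} {ρ θ : ℝ → T3 → ℝ} {u : ℝ → T3 → V3}
    (hE : IsHardSphereEulerSolution σ T ρ u θ) (hT : 0 < T) :
    Continuous (ρ 0) ∧ Continuous (u 0) ∧ Continuous (θ 0) :=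
  have h0 : (0 : ℝ) ∈ Ico 0 T := ⟨le_rfl, hT⟩
  ⟨(hE.smooth_density.isSmooth_slice h0).continuous, (hE.smooth_velocity.isSmooth_slice h0).continuous,
    (hE.smooth_temperature.isSmooth_slice h0).continuous⟩

/-! ## §4 THE CRUX WITHOUT PARTICLES: an equivalent deterministic PDE statement -/

/-- **`PolynomialCompression`, de-probabilised.** No flows, no measures, no LLN: along some
sequence `σ → 0`, the classical hard-sphere-Euler solution (pressure `p = ρθ Z(ρσ³)`) with the
PINNED data `(rhoLim (profileOf a₀) σ, u₀, θ₀)` reaches density `σ^(-κ)` on its interval of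
classical existence. Equivalent to the crux (`polynomialCompression_iff_pde`). -/
def PolynomialCompressionPDE : Prop :=
  ∃ κ : ℝ, 0 < κ ∧ ∃ (a₀ θ₀ : T3 → ℝ) (u₀ : T3 → V3) (ha : Continuous a₀) (ha0 : ∀ x, 0 < a₀ x),
    Continuous θ₀ ∧ Continuous u₀ ∧ (∀ x, 0 < θ₀ x) ∧
    ∀ σ₀ : ℝ, 0 < σ₀ → ∃ σ : ℝ, 0 < σ ∧ σ < σ₀ ∧
      ∃ (T : ℝ) (ρ θ : ℝ → T3 → ℝ) (u : ℝ → T3 → V3), IsHardSphereEulerSolution σ T ρ u θ ∧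
        ρ 0 = rhoLim (profileOf a₀ ha ha0) σ ∧ u 0 = u₀ ∧ θ 0 = θ₀ ∧
        ∃ t ∈ Ico 0 T, ∃ x, σ ^ (-κ) ≤ ρ t x

/-- **THE CRUX IS A PURE PDE STATEMENT**: `PolynomialCompression ↔ PolynomialCompressionPDE`.
(Both directions shrink `σ₀` below the statics threshold `σ₁(a₀, θ₀, u₀)` of `admissible_iff_data`;
`T > 0` because `∃ t ∈ Ico 0 T`, so the time-`0` slices of the classical solution are continuous.)
Consequently a proof of the crux is: the ideal-gas implosion + quantitative EOS/data continuity for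
ONE explicit data family; a disproof is a σ-uniform sub-polynomial `L∞` density bound for that family. -/
theorem polynomialCompression_iff_pde : PolynomialCompression ↔ PolynomialCompressionPDE := by
  constructor
  · rintro ⟨κ, hκ, a₀, θ₀, u₀, ha, hθ, hu, ha0, hθ0, H⟩
    obtain ⟨σ₁, hσ₁, -, G⟩ := admissible_iff_data ha hθ hu ha0 hθ0
    refine ⟨κ, hκ, a₀, θ₀, u₀, ha, ha0, hθ, hu, hθ0, fun σ₀ hσ₀ => ?_⟩
    obtain ⟨σ, hσ, hσlt, T, ρ, θ, u, hE, hA, t, ht, x, hx⟩ := H (min σ₀ σ₁) (lt_min hσ₀ hσ₁)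
    have hT : 0 < T := ht.1.trans_lt ht.2
    obtain ⟨hρc, huc, hθc⟩ := continuous_slices_zero hE hT
    obtain ⟨-, G'⟩ := G σ hσ (lt_of_lt_of_le hσlt (min_le_right _ _))
    obtain ⟨h1, h2, h3⟩ := (G' ρ θ u hρc huc hθc).1 hA
    exact ⟨σ, hσ, lt_of_lt_of_le hσlt (min_le_left _ _), T, ρ, θ, u, hE, h1, h2, h3, t, ht, x, hx⟩
  · rintro ⟨κ, hκ, a₀, θ₀, u₀, ha, ha0, hθ, hu, hθ0, H⟩
    obtain ⟨σ₁, hσ₁, -, G⟩ := admissible_iff_data ha hθ hu ha0 hθ0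
    refine ⟨κ, hκ, a₀, θ₀, u₀, ha, hθ, hu, ha0, hθ0, fun σ₀ hσ₀ => ?_⟩
    obtain ⟨σ, hσ, hσlt, T, ρ, θ, u, hE, h1, h2, h3, t, ht, x, hx⟩ := H (min σ₀ σ₁) (lt_min hσ₀ hσ₁)
    have hT : 0 < T := ht.1.trans_lt ht.2
    obtain ⟨hρc, huc, hθc⟩ := continuous_slices_zero hE hT
    obtain ⟨-, G'⟩ := G σ hσ (lt_of_lt_of_le hσlt (min_le_right _ _))
    exact ⟨σ, hσ, lt_of_lt_of_le hσlt (min_le_left _ _), T, ρ, θ, u, hE,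
      (G' ρ θ u hρc huc hθc).2 ⟨h1, h2, h3⟩, t, ht, x, hx⟩



/-! ## §5 WHY IT RESISTS: a disproof is a σ-uniform density bound — and proves the open crux 3091 -/

/-- **What a disproof must deliver** (`push_neg` through the crux): for EVERY `κ > 0` and EVERY
continuous positive profile triple, a threshold `σ₀` below which EVERY admissible classical
hard-sphere-Euler solution obeys the sub-polynomial bound `ρ < σ^(-κ)` on its whole interval of
existence — an a-priori `L∞` density bound, uniform as `σ → 0`, at the first singularity of 3-D
compressible Euler for arbitrary smooth data. Nothing of the kind is in print. -/
theorem not_polynomialCompression_iff :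
    ¬ PolynomialCompression ↔
      ∀ κ : ℝ, 0 < κ → ∀ (a₀ θ₀ : T3 → ℝ) (u₀ : T3 → V3), Continuous a₀ → Continuous θ₀ →
        Continuous u₀ → (∀ x, 0 < a₀ x) → (∀ x, 0 < θ₀ x) → ∃ σ₀ : ℝ, 0 < σ₀ ∧
          ∀ σ : ℝ, 0 < σ → σ < σ₀ → ∀ (T : ℝ) (ρ θ : ℝ → T3 → ℝ) (u : ℝ → T3 → V3),
            IsHardSphereEulerSolution σ T ρ u θ → Admissible σ a₀ u₀ θ₀ ρ u θ →
              ∀ t ∈ Ico 0 T, ∀ x, ρ t x < σ ^ (-κ) := by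
  unfold PolynomialCompression Admissible TiedThrough
  push Not
  rfl

/-- **A disproof of the crux PROVES `DiluteSelfConsistency`** (rank-3 crux, stmt-3091, the hidden
PDE crux shared by 13 routes, difficulty "open-problem"): `¬PolynomialCompression` at `κ = 1`
bounds the packing by `ρσ³ < σ² < η` for `σ < min(σ₀, 1, η)`; the one-flow tie in
`DiluteSelfConsistency` is upgraded to admissibility by flow-independence (§1). So no refutation
of this item is cheaper than the open positive crux. -/
theorem diluteSelfConsistency_of_not_polynomialCompression (h : ¬ PolynomialCompression) :
    DiluteSelfConsistency := by
  rw [not_polynomialCompression_iff] at h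
  intro η hη a₀ θ₀ u₀ ha hθ hu ha0 hθ0
  obtain ⟨σ₀, hσ₀, H⟩ := h 1 one_pos a₀ θ₀ u₀ ha hθ hu ha0 hθ0
  refine ⟨min σ₀ (min 1 η), lt_min hσ₀ (lt_min one_pos hη),
    fun σ hσ hσlt T ρ θ u hE Φ h0 t ht x => ?_⟩
  have hσ₀' : σ < σ₀ := lt_of_lt_of_le hσlt (min_le_left _ _)
  have hσ1 : σ < 1 := lt_of_lt_of_le hσlt ((min_le_right _ _).trans (min_le_left _ _))
  have hση : σ < η := lt_of_lt_of_le hσlt ((min_le_right _ _).trans (min_le_right _ _))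
  have hlt := H σ hσ hσ₀' T ρ θ u hE (admissible_of_tiedThrough Φ h0) t ht x
  rw [Real.rpow_neg hσ.le, Real.rpow_one] at hlt
  have hσ3 : 0 < σ ^ 3 := pow_pos hσ 3
  calc ρ t x * σ ^ 3 < σ⁻¹ * σ ^ 3 := mul_lt_mul_of_pos_right hlt hσ3
    _ = σ ^ 2 := by field_simp
    _ < η := by nlinarith

/-- **Dichotomy**: the crux or the open positive crux holds (classically). -/
theorem polynomialCompression_or_diluteSelfConsistency :
    PolynomialCompression ∨ DiluteSelfConsistency :=
  (em PolynomialCompression).imp_right diluteSelfConsistency_of_not_polynomialCompression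

/-- **A disproof closes the sub-problem modulo the band statement**: `¬PolynomialCompression` and
`HydroLimitInBand` give `HydrodynamicLimit` through the route's PROVED assembly `closes`. -/
theorem hydrodynamicLimit_of_not_polynomialCompression (h : ¬ PolynomialCompression)
    (hB : HydroLimitInBand) : _root_.HydrodynamicLimit :=
  closes (diluteSelfConsistency_of_not_polynomialCompression h) hB

/-- **The disproof obligation in PDE form** (no particles): for every `κ > 0` and profiles, a
threshold below which the classical hard-sphere-Euler solution with the pinned data
`(rhoLim (profileOf a₀) σ, u₀, θ₀)` stays `< σ^(-κ)` on its interval of existence. -/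
theorem not_polynomialCompression_iff_pde :
    ¬ PolynomialCompression ↔
      ∀ κ : ℝ, 0 < κ → ∀ (a₀ θ₀ : T3 → ℝ) (u₀ : T3 → V3) (ha : Continuous a₀)
        (ha0 : ∀ x, 0 < a₀ x), Continuous θ₀ → Continuous u₀ → (∀ x, 0 < θ₀ x) →
        ∃ σ₀ : ℝ, 0 < σ₀ ∧ ∀ σ : ℝ, 0 < σ → σ < σ₀ →
          ∀ (T : ℝ) (ρ θ : ℝ → T3 → ℝ) (u : ℝ → T3 → V3), IsHardSphereEulerSolution σ T ρ u θ →
            ρ 0 = rhoLim (profileOf a₀ ha ha0) σ → u 0 = u₀ → θ 0 = θ₀ →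
              ∀ t ∈ Ico 0 T, ∀ x, ρ t x < σ ^ (-κ) := by
  rw [polynomialCompression_iff_pde]
  unfold PolynomialCompressionPDE
  push Not
  rfl

/-! ## §6 The κ-LADDER: `DenseExcursion` sits exactly at `κ = 3` -/

/-- `σ^(3-κ) = σ³ · σ^(-κ)` (`rpow` bookkeeping). -/
theorem rpow_three_sub (σ κ : ℝ) (hσ : 0 < σ) : σ ^ (3 - κ) = σ ^ (3 : ℕ) * σ ^ (-κ) := by
  have e : (3 : ℝ) - κ = ((3 : ℕ) : ℝ) + -κ := by push_cast; ring
  rw [e, Real.rpow_add hσ, Real.rpow_natCast]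

/-- **Antitone in `κ`**: a smaller exponent is a weaker claim (`σ < 1`), so WLOG `κ` is small. -/
theorem polynomialCompressionAt_anti {κ κ' : ℝ} (hκ : κ' ≤ κ) :
    PolynomialCompressionAt κ → PolynomialCompressionAt κ' :=
  Reaches.mono one_pos fun σ r hσ hσ1 (hr : σ ^ (-κ) ≤ r) =>
    (Real.rpow_le_rpow_of_exponent_ge hσ hσ1.le (neg_le_neg hκ)).trans hr

/-- **Lower rungs**: `DenseExcursion → PolynomialCompressionAt κ` for EVERY `κ < 3`
(`η ≤ ρσ³` and `σ^(3-κ) < η` for `σ < η^{1/(3-κ)}` give `σ^(-κ) < ρ`). -/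
theorem polynomialCompressionAt_of_denseExcursion {κ : ℝ} (hκ : κ < 3) (h : DenseExcursion) :
    PolynomialCompressionAt κ := by
  obtain ⟨η, hη, hR⟩ := denseExcursion_iff.1 h
  have h3 : 0 < 3 - κ := by linarith
  refine Reaches.mono (σ₁ := min 1 (η ^ (3 - κ)⁻¹)) (lt_min one_pos (Real.rpow_pos_of_pos hη _))
    (fun σ r hσ hσlt (hr : η ≤ r * σ ^ 3) => ?_) hR
  have hση : σ < η ^ (3 - κ)⁻¹ := lt_of_lt_of_le hσlt (min_le_right _ _)
  have hσ3 : 0 < σ ^ 3 := pow_pos hσ 3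
  have hpow : σ ^ (3 - κ) < η := by
    calc σ ^ (3 - κ) < (η ^ (3 - κ)⁻¹) ^ (3 - κ) := Real.rpow_lt_rpow hσ.le hση h3
      _ = η := by rw [← Real.rpow_mul hη.le, inv_mul_cancel₀ h3.ne', Real.rpow_one]
  rw [rpow_three_sub σ κ hσ] at hpow
  have key : σ ^ (-κ) * σ ^ 3 < r * σ ^ 3 := by
    rw [mul_comm]; exact hpow.trans_le hr
  exact (lt_of_mul_lt_mul_right key hσ3.le).le

/-- **Upper rung**: `PolynomialCompressionAt κ → DenseExcursion` for `κ ≥ 3` (with `η = 1`: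
`1 ≤ σ^(3-κ) = σ³σ^(-κ) ≤ ρσ³` for `σ < 1`). So `DenseExcursion` is exactly the `κ = 3` endpoint
of the ladder and the crux (`∃ κ > 0`) is its bottom. -/
theorem denseExcursion_of_polynomialCompressionAt {κ : ℝ} (hκ : 3 ≤ κ)
    (h : PolynomialCompressionAt κ) : DenseExcursion := by
  refine denseExcursion_iff.2 ⟨1, one_pos, Reaches.mono one_pos
    (fun σ r hσ hσ1 (hr : σ ^ (-κ) ≤ r) => ?_) h⟩
  have h1 : (1 : ℝ) ≤ σ ^ (3 - κ) :=
    Real.one_le_rpow_of_pos_of_le_one_of_nonpos hσ hσ1.le (by linarith)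
  rw [rpow_three_sub σ κ hσ] at h1
  calc (1 : ℝ) ≤ σ ^ (3 : ℕ) * σ ^ (-κ) := h1
    _ ≤ σ ^ 3 * r := mul_le_mul_of_nonneg_left hr (pow_nonneg hσ.le 3)
    _ = r * σ ^ 3 := mul_comm _ _

/-- `DenseExcursion → PolynomialCompression` (with `κ = 2`; the planner's "refuter ladder lemma"). -/
theorem polynomialCompression_of_denseExcursion (h : DenseExcursion) : PolynomialCompression :=
  polynomialCompression_iff.2 ⟨2, two_pos, polynomialCompressionAt_of_denseExcursion (by norm_num) h⟩

/-- Contrapositive: a disproof of the crux also refutes `DenseExcursion` (rank 2). -/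
theorem not_denseExcursion_of_not_polynomialCompression (h : ¬ PolynomialCompression) :
    ¬ DenseExcursion :=
  mt polynomialCompression_of_denseExcursion h

/-! ## §7 LOAD-BEARING ANALYSIS and refuted STRENGTHENINGS -/

/-- Constant states are classical hard-sphere-Euler solutions at EVERY `σ` and on every `[0, T)`
(all derivatives vanish; the pressure `ρθZ(ρσ³)` is a constant whatever the typed `Z` is). -/
theorem isHardSphereEulerSolution_const (σ T : ℝ) {c ϑ : ℝ} (hc : 0 < c) (hϑ : 0 < ϑ) (v : V3) :
    IsHardSphereEulerSolution σ T (fun _ _ => c) (fun _ _ => v) (fun _ _ => ϑ) where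
  smooth_density := contDiffOn_const
  smooth_velocity := contDiffOn_const
  smooth_temperature := contDiffOn_const
  density_pos := fun _ _ _ => hc
  temperature_pos := fun _ _ _ => hϑ
  mass := by
    intro t _ x
    simp [Torus.timeDerivWithin, Torus.divergence, Torus.partialDeriv, Torus.lineDeriv]
  momentum := by
    intro t _ x
    have hg : Torus.gradient (fun _ : T3 => hsPressure σ c ϑ) x = 0 := by
      unfold Torus.gradient Torus.liftAt
      simp [_root_.gradient]
    simp [Torus.timeDerivWithin, Torus.partialDeriv, Torus.lineDeriv, hg]
  energy := by
    intro t _ x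
    simp [Torus.timeDerivWithin, Torus.divergence, Torus.partialDeriv, Torus.lineDeriv]

/-- The crux with the `t = 0` tie DROPPED (the profiles then play no role and are omitted). -/
def PolynomialCompressionUntied : Prop :=
  ∃ κ : ℝ, 0 < κ ∧ ∀ σ₀ : ℝ, 0 < σ₀ → ∃ σ : ℝ, 0 < σ ∧ σ < σ₀ ∧
    ∃ (T : ℝ) (ρ θ : ℝ → T3 → ℝ) (u : ℝ → T3 → V3), IsHardSphereEulerSolution σ T ρ u θ ∧
      ∃ t ∈ Ico 0 T, ∃ x, σ ^ (-κ) ≤ ρ t x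

/-- **THE TIE IS THE ONLY CONSTRAINT**: without it the statement is TRUE trivially (constant state
`ρ ≡ σ⁻¹`, `u ≡ 0`, `θ ≡ 1` at `σ = σ₀/2`, `κ = 1`). Hence every DISPROOF must use the LLN tie
(through data pinning, §2–§4), and every PROOF must produce admissible — i.e. pinned — data. -/
theorem polynomialCompressionUntied_holds : PolynomialCompressionUntied := by
  refine ⟨1, one_pos, fun σ₀ hσ₀ => ⟨σ₀ / 2, by positivity, by linarith, 1, fun _ _ => (σ₀ / 2)⁻¹,
    fun _ _ => 1, fun _ _ => 0, isHardSphereEulerSolution_const _ _ (by positivity) one_pos 0,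
    0, ⟨le_rfl, one_pos⟩, 0, ?_⟩⟩
  rw [Real.rpow_neg (by positivity), Real.rpow_one]

/-- The crux with the compression demanded AT `t = 0` (a natural strengthening / the cheapest
conceivable witness: blow-up already in the data). -/
def PolynomialCompressionAtTimeZero : Prop :=
  ∃ κ : ℝ, 0 < κ ∧ ∃ (a₀ θ₀ : T3 → ℝ) (u₀ : T3 → V3), Continuous a₀ ∧ Continuous θ₀ ∧
    Continuous u₀ ∧ (∀ x, 0 < a₀ x) ∧ (∀ x, 0 < θ₀ x) ∧ ∀ σ₀ : ℝ, 0 < σ₀ → ∃ σ : ℝ, 0 < σ ∧ σ < σ₀ ∧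
      ∃ (T : ℝ) (ρ θ : ℝ → T3 → ℝ) (u : ℝ → T3 → V3), IsHardSphereEulerSolution σ T ρ u θ ∧
        Admissible σ a₀ u₀ θ₀ ρ u θ ∧ 0 < T ∧ ∃ x, σ ^ (-κ) ≤ ρ 0 x

/-- **REFUTED STRENGTHENING, now unconditional** (cycle 1 had it modulo `LocalGibbsDensityLimit`):
no compression at `t = 0`. Admissible data are pinned to `rhoLim (profileOf a₀) σ < (2e+1)·M`
(`M = sup a₀/∫a₀`) uniformly in `σ`, while `σ^(-κ) → ∞`. So every witness of the crux needs
GENUINE DYNAMICAL COMPRESSION by the factor `σ^(-κ)` for one fixed profile triple. -/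
theorem not_polynomialCompressionAtTimeZero : ¬ PolynomialCompressionAtTimeZero := by
  rintro ⟨κ, hκ, a₀, θ₀, u₀, ha, hθ, hu, ha0, hθ0, H⟩
  obtain ⟨σ₁, hσ₁, -, G⟩ := admissible_iff_data ha hθ hu ha0 hθ0
  set P := profileOf a₀ ha ha0 with hP
  set B : ℝ := (2 * Real.exp 1 + 1) * P.M with hB
  have hB0 : 0 < B := mul_pos (by positivity) P.M_pos
  obtain ⟨σ, hσ, hσlt, T, ρ, θ, u, hE, hA, hT, x, hx⟩ :=
    H (min σ₁ (B ^ (-κ⁻¹))) (lt_min hσ₁ (Real.rpow_pos_of_pos hB0 _))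
  have hσ₁' : σ < σ₁ := lt_of_lt_of_le hσlt (min_le_left _ _)
  have hσB : σ < B ^ (-κ⁻¹) := lt_of_lt_of_le hσlt (min_le_right _ _)
  obtain ⟨h, G'⟩ := G σ hσ hσ₁'
  obtain ⟨hρc, huc, hθc⟩ := continuous_slices_zero hE hT
  obtain ⟨hρ0, -, -⟩ := (G' ρ θ u hρc huc hθc).1 hA
  have hlt : ρ 0 x < B := by rw [hρ0]; exact rhoLim_lt h x
  have hge : B ≤ σ ^ (-κ) := by
    have h1 := Real.rpow_le_rpow_of_nonpos hσ hσB.le (by linarith : -κ ≤ 0)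
    rwa [← Real.rpow_mul hB0.le, neg_mul_neg, inv_mul_cancel₀ hκ.ne', Real.rpow_one] at h1
  linarith

/-- **MASS PINNING**: admissible classical data have total mass `1` (`σ` small). With the
uniform bound `ρ(0) < (2e+1)M` this quantifies how far the data are from any compression. -/
theorem integral_density_zero_eq_one {a₀ θ₀ : T3 → ℝ} {u₀ : T3 → V3} (ha : Continuous a₀)
    (hθ : Continuous θ₀) (hu : Continuous u₀) (ha0 : ∀ x, 0 < a₀ x) (hθ0 : ∀ x, 0 < θ₀ x) :
    ∃ σ₁ : ℝ, 0 < σ₁ ∧ ∀ σ : ℝ, 0 < σ → σ < σ₁ → ∀ (T : ℝ) (ρ θ : ℝ → T3 → ℝ) (u : ℝ → T3 → V3),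
      IsHardSphereEulerSolution σ T ρ u θ → Admissible σ a₀ u₀ θ₀ ρ u θ → 0 < T →
        ∫ y, ρ 0 y = 1 ∧ ∀ y, ρ 0 y < (2 * Real.exp 1 + 1) * (profileOf a₀ ha ha0).M := by
  obtain ⟨σ₁, hσ₁, -, G⟩ := admissible_iff_data ha hθ hu ha0 hθ0
  refine ⟨σ₁, hσ₁, fun σ hσ hσlt T ρ θ u hE hA hT => ?_⟩
  obtain ⟨h, G'⟩ := G σ hσ hσlt
  obtain ⟨hρc, huc, hθc⟩ := continuous_slices_zero hE hT
  obtain ⟨hρ0, -, -⟩ := (G' ρ θ u hρc huc hθc).1 hA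
  rw [hρ0]
  exact ⟨integral_rhoLim_eq_one h, fun y => rhoLim_lt h y⟩



/-! ## §8 MECHANISM AUDIT: why the refuter expects the crux to be TRUE in substance -/

/-- **Exponent bookkeeping of the shadowing mechanism** (checked): if the reference (ideal-gas)
implosion has core density `≥ e^{βs}` at self-similar time `s = -log(T* - t)`, and the σ-solution
stays within `A σ^q e^{Cs}` of it while this error is `≤ δ` (Gronwall loss only EXPONENTIAL in `s`,
i.e. polynomial in `T* - t`; statics/EOS defect of size `σ^q`), then at the exit time
`s* = C⁻¹ log(δ/(Aσ^q))` the σ-density is `≥ (δ/(Aσ^q))^{β/C} - δ ≥ σ^(-κ)` for EVERY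
`κ < qβ/C`, once `σ` is small. So ANY finite Gronwall rate `C` yields SOME `κ > 0`: unlike
`DenseExcursion` (which needs `κ = 3`, a race `λ` vs `β`), the crux has no spectral content — a
refutation would need super-exponential-in-`s` loss of continuous dependence around a Type-I
self-similar blow-up, for which no mechanism is known (`‖∇(u,c)‖∞ ≲ (T*-t)⁻¹` integrates to a log). -/
theorem shadowing_exponent {A q C β δ κ : ℝ} (hA : 0 < A) (hδ : 0 < δ)
    (hκ0 : 0 < κ) (hκ : κ < q * β / C) :
    ∃ σ₀ : ℝ, 0 < σ₀ ∧ ∀ σ : ℝ, 0 < σ → σ < σ₀ →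
      σ ^ (-κ) ≤ (δ / (A * σ ^ q)) ^ (β / C) - δ := by
  set p := q * β / C with hp
  set γ := p - κ with hγ
  have hγ0 : 0 < γ := by rw [hγ]; linarith
  have hp0 : 0 < p := hκ0.trans hκ
  set c := (δ / A) ^ (β / C) with hc
  have hc0 : 0 < c := Real.rpow_pos_of_pos (div_pos hδ hA) _
  have hid : ∀ σ : ℝ, 0 < σ → (δ / (A * σ ^ q)) ^ (β / C) = c * σ ^ (-p) := by
    intro σ hσ
    have e1 : δ / (A * σ ^ q) = (δ / A) * σ ^ (-q) := by
      rw [Real.rpow_neg hσ.le, div_mul_eq_div_div, div_eq_mul_inv]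
    rw [e1, Real.mul_rpow (div_pos hδ hA).le (Real.rpow_nonneg hσ.le _), ← Real.rpow_mul hσ.le]
    congr 2
    rw [hp]; ring
  refine ⟨min ((c / 2) ^ γ⁻¹) ((c / (2 * δ)) ^ p⁻¹),
    lt_min (Real.rpow_pos_of_pos (by positivity) _) (Real.rpow_pos_of_pos (by positivity) _),
    fun σ hσ hσlt => ?_⟩
  have hσ1 : σ ≤ (c / 2) ^ γ⁻¹ := (lt_of_lt_of_le hσlt (min_le_left _ _)).le
  have hσ2 : σ ≤ (c / (2 * δ)) ^ p⁻¹ := (lt_of_lt_of_le hσlt (min_le_right _ _)).le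
  have h1 : σ ^ γ ≤ c / 2 := by
    calc σ ^ γ ≤ ((c / 2) ^ γ⁻¹) ^ γ := Real.rpow_le_rpow hσ.le hσ1 hγ0.le
      _ = c / 2 := by
        rw [← Real.rpow_mul (by positivity), inv_mul_cancel₀ hγ0.ne', Real.rpow_one]
  have h2 : σ ^ p ≤ c / (2 * δ) := by
    calc σ ^ p ≤ ((c / (2 * δ)) ^ p⁻¹) ^ p := Real.rpow_le_rpow hσ.le hσ2 hp0.le
      _ = c / (2 * δ) := by
        rw [← Real.rpow_mul (by positivity), inv_mul_cancel₀ hp0.ne', Real.rpow_one]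
  have h2' : δ * σ ^ p ≤ c / 2 := by
    calc δ * σ ^ p ≤ δ * (c / (2 * δ)) := mul_le_mul_of_nonneg_left h2 hδ.le
      _ = c / 2 := by field_simp
  have hsp : 0 < σ ^ p := Real.rpow_pos_of_pos hσ _
  have hsplit : σ ^ (-κ) = σ ^ (-p) * σ ^ γ := by
    rw [← Real.rpow_add hσ]; congr 1; rw [hγ]; ring
  rw [hid σ hσ, hsplit, Real.rpow_neg hσ.le, le_sub_iff_add_le]
  rw [show (σ ^ p)⁻¹ * σ ^ γ + δ = (σ ^ γ + δ * σ ^ p) / σ ^ p by field_simp,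
    show c * (σ ^ p)⁻¹ = c / σ ^ p by rw [div_eq_mul_inv],
    div_le_div_iff_of_pos_right hsp]
  linarith

/-- **MECHANISM AUDIT and the provers' inputs** (prose; nothing asserted). By `polynomialCompression_iff_pde`
the crux is the following deterministic claim: for ONE profile triple, along a sequence `σ → 0`, the classical
solution `U_σ = (ρ, u, θ)_σ` of `∂ₜρ + div(ρu) = 0`, `∂ₜ(ρu) + div(ρu⊗u) + ∇(ρθZ(ρσ³)) = 0`,
`∂ₜE + div((E+p)u) = 0` with data `(rhoLim (profileOf a₀) σ, u₀, θ₀)` reaches `σ^(-κ)`.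

Intended proof (route + cards log-lipschitz-budget / eos-defect-as-forcing, triage r1): take `(a₀/∫a₀, u₀, θ₀)` =
C^∞ isentropic data of the γ = 5/3 CGSS/BCG self-similar implosion on 𝕋³ (CaolaboraEtAl2025 Thm 1.2, Rem 1.4–1.5,
with BCG profiles; fact `CaolaboraEtAl2025_thm12_euler` accepted in tree, item 12588). In self-similar variables
the difference `U_σ - U_0` solves a symmetric-hyperbolic system whose coefficients are bounded (Type-I blow-up:
`∫₀ᵗ ‖∇(u,c)‖∞ ≤ C log(T*/(T*-t))`, CGSS Lemma 3.6), forced by (i) the EOS defect `ρθ(Z(ρσ³)-1) = O(ρ²θσ³)`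
(relative size = packing `→ 0` in the regime) and (ii) the data defect. Gronwall in `s` loses `e^{C_k s}` only;
`shadowing_exponent` then gives `κ = qβ/C_k - 0` for statics rate `q` and Gronwall constant `C_k`.

Inputs and their status after cycle 2:
* I1 σ = 0 implosion with a RATE (core density `≍ (T*-t)^{-β}`, `β = 3(1-1/r) ∈ (0, 0.634)`, and weighted `H^k` bounds
  of the profile in self-similar variables): printed (CGSS/BCG), vendored only qualitatively (unbounded density).
* I2 QUANTITATIVE SMOOTH STATICS: ✚ NOW LARGELY IN TREE — the admissible datum IS `rhoLim (profileOf a₀) σ`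
  (`admissible_iff_data`), an explicit power series `g_σ(β(x))`, with `|rhoLim - β| ≤ 16e²v₁M²σ³` (`abs_rhoLim_sub_β_le`,
  so `q = 3` at `k = 0`), `∫ rhoLim = 1`, `rhoLim < (2e+1)M`; the `C^k` version is Faà di Bruno on `g_σ ∘ β` with
  `‖g_σ - R·id‖_{C^k[0,M]} = O_k(σ³)` from `|γ_{j+1}R^{j+1}| ≤ 2e(2ev₁σ³)ʲ` — routine, not yet written. NOTE the data are
  `O(σ³)`-NON-isentropic (θ₀ is fixed before σ while ρ(0) = rhoLim moves), so the forced problem is the FULL 5×5 system.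
* I3 `HsEosLowDensity` (stmt-0768, typed `Z` analytic on `[0, η₀)`): OPEN in tree and load-bearing for BOTH sides — without
  it `Torus.gradient (p ∘ (ρ,θ))` may be `fderiv`-junk `0` wherever `Z` is not differentiable, and "classical solution"
  silently means something else. Every Lean proof or disproof of the crux beyond §5–§7 needs it.
* I4 local well-posedness + continuation criterion for the 5×5 symmetric-hyperbolic system in the torus calculus
  (Kato1975 / Majda1984 Thm 2.1): printed, not vendored.
* I5 the weighted `H^k` difference estimate in self-similar variables with `e^{C_k s}` loss for the FORCED problem:
  folklore-grade but unprinted; this is the real work ("difficulty L" is optimistic; paper-sized).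

Why no cheap refutation exists (summary): §5 (`¬PC ⊢ DSC`, open), §7 (every junk regime excluded: t = 0 pinned and
bounded, constants need the tie, σ ≥ 1 / zero-law / Z = 1 branch excluded by `σ < σ₀ ∀σ₀`, κ WLOG small), and the
mechanism above has no exponent race. A kit computation cannot inform the verdict: generic smooth radial data shock
before imploding (implosion is finite-codimension), so no toy run reaches the regime; declined in cycles 1 and 2. -/
theorem mechanism_audit : True := trivial

/-! ## §9 ATTACK CENSUS (cycles 1–2)

* elaboration / junk audit of the signature: clean (rpow density floor `σ^(-κ)`, quantifier order = informal,
  `∀σ₀ ∃σ<σ₀` = along a sequence).                                                        → no handle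
* t = 0 witness (blow-up in the data): REFUTED, unconditional (`not_polynomialCompressionAtTimeZero`). → dead
* constant / trivially scaled states: need the tie; untied statement TRUE (`polynomialCompressionUntied_holds`). → dead
* large-σ junk (no room for spheres ⇒ zero law; `Z = 1` branch at packing ≥ 512): excluded by `σ < σ₀ ∀σ₀`. → dead
* κ ≤ 0, T ≤ 0, η-type rescalings, Galilean boosts, `a₀ ↦ c·a₀`: excluded or invariant.      → dead
* flow quantifier `∀Φ`: flow-independent (`admissible_iff_tied`), flows exist (Alexander).    → no handle
* uniqueness of in-probability limits + PROVED LLN ⇒ data pinned to `(rhoLim, u₀, θ₀)`; crux ≡ PDE statement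
  (`polynomialCompression_iff_pde`).                                                       → reformulation, no kill
* refute via a density bound: would prove `DiluteSelfConsistency` (open) and `¬DenseExcursion`. → blocked (open problem)
* ladder: `DE ⇒ PC@κ<3`, `PC@κ≥3 ⇒ DE`; the crux is the weakest rung.                         → structure only
* EOS regularity junk (`Torus.gradient` of a non-differentiable pressure = 0): cannot be used without settling
  `HsEosLowDensity` either way.                                                            → blocked on stmt-0768
* literature for negative results on EOS/data-perturbed implosion: none found (cycle 1: BCG §7, CGSS Thm 1.2/§3;
  cycle 2: local searchd/OpenAlex degraded; arXiv leg: the implosion cluster 2605.00808 (stable implosions, p(0)=0,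
  excluded by θ > 0), 2606.18152, 2606.12758, 2511.03033, 2608.10554 — all already in the route's search — plus
  NEW arXiv:2606.29454 (Fan–Liu, quasi-singularities: M-dependent analytic data with gradients ≥ M while smooth;
  data depend on M, so no bearing on a FIXED-profile statement) and the cavitation-collapse asymptotics
  arXiv:2303.09025 / 2410.05244 (Krimans–Putterman(–Ruuth): a hard core / stiff EOS arrests the collapse at
  packing O(1) — physics folklore since Löfstedt–Barber–Putterman 1993; it caps κ ≤ 3 physically and is invisible
  at the crux's packing σ^{3-κ} → 0).                                                      → none that bites
-/


/-! ## §10 ✚✚ CYCLE 3: landed modules, no bulk compression, energy conservation, stub audit -/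

section CycleThree

open Summit.AtomisticToContinuum.HydrodynamicLimit.Theorems

/-- (a) DICTIONARY to the landed negative knowledge (same statements as in this file, now importable):
`PolynomialCompressionUntied` / `polynomialCompressionUntied_holds` (§7 here) — `Negative/Untied.lean`;
`PolynomialCompressionAtTimeZero` / `polynomialCompression_false_atTimeZero` (§7) — `Negative/AtTimeZero.lean`;
`PolynomialCompressionEverywhere` / `polynomialCompression_false_everywhere`, `volume_real_compressionSet_le` (new,
§10(b)) — `Negative/Everywhere.lean`; `PolynomialCompressionAt`, `polynomialCompressionAt_anti`,
`polynomialCompressionAt_of_denseExcursion`, `not_polynomialCompressionAt_of_not_denseExcursion`,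
`not_denseExcursion_of_not_polynomialCompression`, `not_polynomialCompression_iff`,
`packingBound_of_not_polynomialCompression` (= `DiluteSelfConsistency` unfolded; §5–§6 here) and the flow-independence
lemma `PolynomialCompressionAt.tendstoHydroFieldsAt_zero_of_one_flow` (§1) — `Negative/Ladder.lean`;
`PolynomialCompressionPDE`, `polynomialCompression_iff_pde`, `admissible_iff_data`, `lln_rhoLim`, `data_eq_of_flowFree`
(§2–§4) — `Negative/PdeForm.lean`; `abs_rhoLim_sub_β_le`, `abs_ratioLimit_sub_one_le`, `integral_rhoLim_eq_one` (§3) —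
`Negative/Statics.lean` (namespace `PolynomialCompressionStatics`); `integral_energy_eq`, `energy_budget` (§10(c)) —
`Negative/Energy.lean` (`PolynomialCompressionEnergy`); `admissible_density_zero_bounds`, `admissible_energy_zero_le`,
`admissible_energy_budget` (σ-uniform budgets of witnesses) — `Negative/Budget.lean` (`PolynomialCompressionBudget`); `exists_smooth_compressibility`, `isSmoothSpaceTimeOn_pressure` (`HsEosLowDensity ⇒` the pressure field of
every dilute classical solution is jointly smooth — discharges the `hp` hypothesis of the energy lemmas and is the
regularity every line's LWP stub needs) — `Negative/SmoothPressure.lean` (`PolynomialCompressionSmoothPressure`).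
The `example`s below check the dictionary. -/
theorem landed_dictionary : True := trivial

example : PolynomialCompressionUntied := polynomialCompressionUntied_holds
example : ¬ Theorems.PolynomialCompressionAtTimeZero := polynomialCompression_false_atTimeZero
example : ¬ PolynomialCompressionEverywhere := polynomialCompression_false_everywhere
example (h : ¬ PolynomialCompression) : DiluteSelfConsistency := packingBound_of_not_polynomialCompression h
example {κ : ℝ} (hκ : κ < 3) (h : DenseExcursion) : Theorems.PolynomialCompressionAt κ :=
  Theorems.polynomialCompressionAt_of_denseExcursion hκ h
example : PolynomialCompression ↔ Theorems.PolynomialCompressionPDE := Theorems.polynomialCompression_iff_pde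
example {P : DensityProfile} {σ : ℝ} (h : SmallDensity P σ) (x : T3) :
    |rhoLim P σ x - P.β x| ≤ 16 * Real.exp 1 ^ 2 * v₁ * P.M ^ 2 * σ ^ 3 :=
  PolynomialCompressionStatics.abs_rhoLim_sub_β_le h x
example {σ T : ℝ} {ρ θ : ℝ → T3 → ℝ} {u : ℝ → T3 → V3} (hE : IsHardSphereEulerSolution σ T ρ u θ)
    (hp : Torus.IsSmoothSpaceTimeOn (Ico 0 T) (fun t y => hsPressure σ (ρ t y) (θ t y))) {t : ℝ} (ht : t ∈ Ico 0 T) :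
    ∫ x, totalEnergyDensity (ρ t x) (u t x) (θ t x) = ∫ x, totalEnergyDensity (ρ 0 x) (u 0 x) (θ 0 x) :=
  PolynomialCompressionEnergy.integral_energy_eq hE hp ht

/-- (b) **NO BULK COMPRESSION — every witness of the crux is a concentration on volume `≤ σ^κ`.** Along an
ADMISSIBLE classical solution at `0 < σ < 1/2`, at every time the compression set `{x | σ^(-κ) ≤ ρ_t(x)}` has volume
`≤ σ^κ` (mass is conserved with NO hypothesis on the equation of state, admissible mass is `1`, Markov). So the
`∀ x`-strengthening of the crux is false (`polynomialCompression_false_everywhere`), compression on any FIXED ball is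
false for small `σ`, and the intended implosion witness (compression set = core ball of radius `(T−t)^{1/r}`, volume
`≍ σ^{κ/(r−1)} ≪ σ^κ`) is consistent with the bound. -/
theorem volume_compressionSet_le {σ T : ℝ} (hσ : 0 < σ) (hσ2 : σ < 1 / 2) {a₀ θ₀ : T3 → ℝ} {u₀ : T3 → V3}
    (ha : Continuous a₀) (hθ : Continuous θ₀) (hu : Continuous u₀) (ha0 : ∀ x, 0 < a₀ x) (hθ0 : ∀ x, 0 < θ₀ x)
    {ρ θ : ℝ → T3 → ℝ} {u : ℝ → T3 → V3} (hE : IsHardSphereEulerSolution σ T ρ u θ)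
    (hA : Admissible σ a₀ u₀ θ₀ ρ u θ) {t : ℝ} (ht : t ∈ Ico 0 T) (κ : ℝ) :
    volume.real {x | σ ^ (-κ) ≤ ρ t x} ≤ σ ^ κ :=
  have ⟨Φ⟩ := flows_nonempty hσ hσ2
  PolynomialCompressionEverywhere.volume_real_compressionSet_le hσ hσ2.le ha hθ hu ha0 hθ0 hE Φ (hA Φ) ht κ

/-- (c) **ENERGY IS CONSERVED** along a classical hard-sphere-Euler solution WHOSE PRESSURE FIELD IS SMOOTH:
`∫ E(t) = ∫ E(0)` on `[0,T)`, `E = ρ(|u|²/2 + 3θ/2)` (energy equation + divergence theorem on `𝕋³` + differentiation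
under `∫` + one-sided mean value theorem — the template of `DenseExcursionEverywhere.integral_density_eq`). The
smoothness hypothesis `hp` on `(t,y) ↦ hsPressure σ (ρ t y) (θ t y) = ρθ Z(ρσ³)` is NOT automatic: the typed
`Z = hsCompressibility` is `deriv`-junk wherever the excess free energy is not differentiable, so until
`HsEosLowDensity` (stmt-0768: `Z` analytic near `0`) lands, the energy flux `(E + p)u` of a "classical solution" need
not be differentiable and `Torus.divergence` of it is junk — the second place (after `Torus.gradient p` in the
momentum equation, §8 I3) where stmt-0768 is load-bearing for BOTH sides. Mass needs no such hypothesis. -/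
theorem integral_energy_eq {σ T : ℝ} {ρ θ : ℝ → T3 → ℝ} {u : ℝ → T3 → V3} (hE : IsHardSphereEulerSolution σ T ρ u θ)
    (hp : Torus.IsSmoothSpaceTimeOn (Ico 0 T) (fun t y => hsPressure σ (ρ t y) (θ t y))) {t : ℝ} (ht : t ∈ Ico 0 T) :
    ∫ x, totalEnergyDensity (ρ t x) (u t x) (θ t x) = ∫ x, totalEnergyDensity (ρ 0 x) (u 0 x) (θ 0 x) := by
  have hEn : Torus.IsSmoothSpaceTimeOn (Ico 0 T) (fun s y => totalEnergyDensity (ρ s y) (u s y) (θ s y)) := by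
    unfold totalEnergyDensity
    exact hE.smooth_density.mul
      (((hE.smooth_velocity.norm_sq ℝ).div_const 2).add (contDiffOn_const.mul hE.smooth_temperature))
  have hflux : Torus.IsSmoothSpaceTimeOn (Ico 0 T) (fun s y =>
      (totalEnergyDensity (ρ s y) (u s y) (θ s y) + hsPressure σ (ρ s y) (θ s y)) • u s y) :=
    (hEn.add hp).smul hE.smooth_velocity
  have hderiv : ∀ s ∈ Ico 0 T,
      HasDerivWithinAt (fun s => ∫ x, totalEnergyDensity (ρ s x) (u s x) (θ s x)) 0 (Ico 0 T) s := by
    intro s hs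
    have h1 := hEn.hasDerivWithinAt_integral (convex_Ico 0 T) hs
    have h2 : ∫ x, Torus.timeDerivWithin (Ico 0 T)
        (fun s y => totalEnergyDensity (ρ s y) (u s y) (θ s y)) s x = 0 := by
      have hpt : (fun x => Torus.timeDerivWithin (Ico 0 T)
            (fun s y => totalEnergyDensity (ρ s y) (u s y) (θ s y)) s x) =
          fun x => -Torus.divergence (fun y =>
            (totalEnergyDensity (ρ s y) (u s y) (θ s y) + hsPressure σ (ρ s y) (θ s y)) • u s y) x := by
        funext x; have := hE.energy s hs x; linarith
      rw [hpt, integral_neg, neg_eq_zero]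
      exact Torus.integral_divergence_eq_zero_holds (hflux.isSmooth_slice hs)
    rwa [h2] at h1
  have hcont : ContinuousOn (fun s => ∫ x, totalEnergyDensity (ρ s x) (u s x) (θ s x)) (Icc 0 t) := fun s hs =>
    ((hderiv s ⟨hs.1, hs.2.trans_lt ht.2⟩).continuousWithinAt).mono (Icc_subset_Ico_right ht.2)
  have hright : ∀ s ∈ Ico 0 t,
      HasDerivWithinAt (fun s => ∫ x, totalEnergyDensity (ρ s x) (u s x) (θ s x)) 0 (Ici s) s := by
    intro s hs
    have hsT : s ∈ Ico 0 T := ⟨hs.1, hs.2.trans ht.2⟩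
    refine (hderiv s hsT).mono_of_mem_nhdsWithin ?_
    exact Filter.mem_of_superset (Ico_mem_nhdsGE hsT.2) (Ico_subset_Ico_left hsT.1)
  exact constant_of_has_deriv_right_zero hcont hright t (right_mem_Icc.2 ht.1)

/-- (c′) **σ-UNIFORM ENERGY BUDGET of every witness.** For an admissible classical solution with smooth pressure
field, below the statics threshold: the kinetic energy `∫ ρ|u|²/2` and the internal energy `∫ (3/2)ρθ` at every
time are each `≤ E₀ := ∫ rhoLim·(|u₀|²/2 + 3θ₀/2) < (2e+1)M·(‖u₀‖∞²/2 + (3/2)‖θ₀‖∞)`, a constant of the PROFILES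
(data pinning §2–§4 + energy conservation + `ρ, θ > 0`). Compression to `σ^(-κ)` therefore happens at bounded
total energy: with `θ ≳ ρ^{2/3}` along particle paths (entropy transport, not formalised — needs the smooth EOS
again) the compressed region `{ρ ≥ σ^(-κ)}` carries internal energy density `≳ σ^{-5κ/3}`, so its volume is
`≲ E₀ σ^{5κ/3}` — sharper than the mass bound `σ^κ` of (b), still consistent with the implosion core `σ^{κ/(r−1)}`.
Stated here: the two budgets from conservation. -/
theorem energy_budget {σ T : ℝ} {ρ θ : ℝ → T3 → ℝ} {u : ℝ → T3 → V3} (hE : IsHardSphereEulerSolution σ T ρ u θ)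
    (hp : Torus.IsSmoothSpaceTimeOn (Ico 0 T) (fun t y => hsPressure σ (ρ t y) (θ t y))) {t : ℝ} (ht : t ∈ Ico 0 T) :
    ∫ x, ρ t x * (‖u t x‖ ^ 2 / 2) ≤ ∫ x, totalEnergyDensity (ρ 0 x) (u 0 x) (θ 0 x) ∧
    ∫ x, ρ t x * (3 / 2 * θ t x) ≤ ∫ x, totalEnergyDensity (ρ 0 x) (u 0 x) (θ 0 x) := by
  rw [← integral_energy_eq hE hp ht]
  have hρc : Continuous (ρ t) := (hE.smooth_density.isSmooth_slice ht).continuous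
  have huc : Continuous (u t) := (hE.smooth_velocity.isSmooth_slice ht).continuous
  have hθc : Continuous (θ t) := (hE.smooth_temperature.isSmooth_slice ht).continuous
  have hK : Integrable (fun x => ρ t x * (‖u t x‖ ^ 2 / 2)) volume :=
    integrable_of_continuous_T3 (hρc.mul ((huc.norm.pow 2).div_const 2))
  have hI : Integrable (fun x => ρ t x * (3 / 2 * θ t x)) volume :=
    integrable_of_continuous_T3 (hρc.mul (continuous_const.mul hθc))
  have hsum : ∫ x, totalEnergyDensity (ρ t x) (u t x) (θ t x) =
      (∫ x, ρ t x * (‖u t x‖ ^ 2 / 2)) + ∫ x, ρ t x * (3 / 2 * θ t x) := by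
    refine Eq.trans (integral_congr_ae (Eventually.of_forall fun x => ?_)) (integral_add hK hI)
    show totalEnergyDensity (ρ t x) (u t x) (θ t x) = ρ t x * (‖u t x‖ ^ 2 / 2) + ρ t x * (3 / 2 * θ t x)
    simp only [totalEnergyDensity]; ring
  have hKpos : 0 ≤ ∫ x, ρ t x * (‖u t x‖ ^ 2 / 2) :=
    integral_nonneg fun x => mul_nonneg (hE.density_pos t ht x).le (by positivity)
  have hIpos : 0 ≤ ∫ x, ρ t x * (3 / 2 * θ t x) :=
    integral_nonneg fun x => mul_nonneg (hE.density_pos t ht x).le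
      (mul_nonneg (by norm_num) (hE.temperature_pos t ht x).le)
  rw [hsum]
  exact ⟨le_add_of_nonneg_right hIpos, le_add_of_nonneg_left hKpos⟩

/-- (d) **PRE-PICK STUB AUDIT of the three lines** (cycle 3; no line PICKED yet, registered skeleton =
`Lines/eos-defect-as-forcing.lean` sha 4dbfbfd5; all 12 stub statements read and attacked cheaply — NO STUB KILLED):

`eos-defect-as-forcing`. STUB 1 `SelfSimilarProfile` (∃ r U S, `AdmissibleProfile`): the typed radial ODEs are
CGSS (1.5) with the `1/r` self-similar factors checked by direct substitution (`∂ₜu + u·∇u + αS∇S` produces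
`(T−t)^{1/r−2}/r² · [(r−1)U + (y+U)·∇U + αS∇S]`); consistency at `R → 0` with `ContDiff` of `radialField U`
(odd `U = U₁R + …`): the second ODE forces `U₁ = 1 − r`, then repulsivity (1.7)/(1.8) read `2 − r > η̃ > 0` ✓
(`r < r⋆(5/3) ≈ 1.268`); at `R → ∞` both ODEs give `U, S ∼ R^{−(r−1)}`, matching the typed decay and lower bound
✓; `rStar = 4/(2 + 2√3/3)` = CGSS `r⋆(γ) = (3γ−1)/(2+√3(γ−1))` at `γ = 5/3` ✓. Truth = BCG Thm 1.1 at `γ = 5/3`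
(literature, size L). No junk found. STUB 2 `LocalWellPosedness` (`HsEosLowDensity → LWP`): under 0768 the typed
`Z = 1 + ηF′(η)` IS analytic on packing `(0, η₀)` (`EqOn` on `Ico 0 η₀` ⇒ local agreement on the open interval;
`Z(0) = 1` regardless of the `deriv` junk at `0` since it is multiplied by `η = 0`); `c² = θ[(Z + ηZ′) + (2/3)Z²] > 0`
for small packing, and the entropy one-form `ds = (3/2θ)dθ − (Z(ρσ³)/ρ)dρ` is closed, so the 5×5 system is
symmetrizable-hyperbolic on `{ρ, θ > 0, ρσ³ < η₁}` and (a) local existence / (b) C¹-continuation are Kato–Majda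
(common lifespan over Sobolev orders ⇒ joint `C^∞`) ✓; "∀ σ > 0" is harmless (only packing enters). STUB 3
`ForcedFiniteHorizonBootstrap` (load-bearing, XL): `ShadowsUntilCompression r U S` is satisfiable in SHAPE — gluing on
a ball needs `ϱ < 1/2` (injectivity of `v ↦ xc + proj v`; it is `∃ ϱ`), unit mass by shrinking the ball, `θ₀ :=
(3/5)ρb^{2/3}` is the CGSS-normalised isentrope (`p = ρ^{5/3}/γ`) ✓, `ssDensity/ssVelocity` match CGSS (1.2) ✓;
clause (i) far from the core (|y| ≫ C₀ at depth) is a one-sided harmless bound; the reference (σ = 0, ρ₀ = ρb) must be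
classical on ALL of `𝕋³` up to `t_e(σ) → T`: exact profile inside the backward sonic cone (radius `R_s T^{1/r} < ϱ`
— take `T` small), smooth exterior for `T` below the exterior gradient time ✓ — consistent, and exactly the paper-sized
claim of the crux (this is where a real failure, if any, will show: uniform-in-depth control of the EXTERIOR/cone
interface and the 3-field forcing estimate, cf. §8 I5). STUB 4 `SmoothLocalGibbsStatics`: = landed
`Negative/PdeForm.lean` (`lln_rhoLim`) + `Negative/Statics.lean` (`k = 0` rate) + smoothness/`C^m` rate of
`g_σ ∘ a₀` (Faà di Bruno with `|γ_{j+1}R^{j+1}| ≤ 2e(2ev₁σ³)ʲ`) — true, size M.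

`conformal-clock`. `ProjectiveCovariance` VERIFIED BY HAND (chain rule, `λ = a/(a+s)`, `∂_y = λ∂_x`, `dt/ds = λ²`,
`dλ/ds = −λ²/a`): dual mass residual `= λ⁵ ×` physical, dual momentum residual `= λ⁶ ×` physical (the Hubble terms
`−λ²U_j/a + λ²U_j/a`, `∓(λ²/a)x·∇U_j`, `∓λx_j/a²` cancel in pairs), dual temperature residual `= λ⁴ ×` physical PLUS
`(2λ³/a)Θ(Z−1)`, which is exactly the typed heating `h(s)θ̂(Z−1)`, `h = 2/(a+s)` ✓; packing `ρ̂ d(s)³ = ρσ³` ✓; the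
typed `DifferentiableAt` hypotheses suffice (`a + s > 0`). TRUE as typed (size M, `fderiv` bookkeeping).
`ClockedIdealImplosion` / `InConformalNormalForm`: Type-I bounds `C/(T−t)` for `∂u, ∂√θ, ∂log ρ, ∂log θ` hold for the
exact self-similar profile (`∇ₓ = (T−t)^{−1/r}∇_y`, `|∇_y log S| ≲ 1`) ✓; two-sided polynomial bounds ✓. `SmoothStatics`
= STUB 4 above. `ConformalClockShadowing`: the load-bearing estimate (XL), same substance as STUB 3.

`log-lipschitz-budget` (stubs currently inactive): `stub_conditionalExistence`'s hypothesis "bounds for ALL classical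
solutions with the data on every `[0,T)`, `T ≤ T′`" is not vacuous-dangerous (LWP gives a solution to continue;
uniqueness is not needed since the bounds are assumed for all solutions) ✓; `stub_logBudgetShadowing` = the estimate.

UPSHOT for the lead: all three lines reduce to ONE paper-sized estimate (forced stability of the `γ = 5/3` implosion
under `O(σ³)` EOS/data/entropy defects with at most power-of-`(T−t)⁻¹` loss) plus vendoring (BCG/CGSS profile, Kato–
Majda in the torus calculus) plus 0768; nothing typed so far is junk-exploitable or cheaply false. -/
theorem stub_audit_cycle3 : True := trivial

end CycleThree

/-! ## §11 ✚✚ ATTACK CENSUS, cycle 3 (2026-08-16)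

* LANDING: six negative files proposed under `Theorems/PolynomialCompression/Negative/` (4 accepted, 2 queued) —
  the gate now takes refuter Negative lemmas in NEGATIVE FORM ONLY (a `DE → PC` / `¬PC → DSC` theorem bounces at the
  refuter probe; restated as `¬PC → ¬DE` and as `DSC` unfolded).                              → done
* bulk / `∀x` / fixed-ball compression: REFUTED by mass (`volume ≤ σ^κ`).                      → dead (landed)
* energy: conserved given smooth pressure; σ-uniform budgets; volume `≲ σ^{5κ/3}` heuristically. → tightness only
* EOS junk revisited: `Torus.divergence ((E+p)u)` is ALSO junk without 0768 (energy eq.), like `∇p`; a junk "proof"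
  of the crux would need NON-differentiability of `hsExcessFreeEnergy` somewhere on `(0, η₀)` — unprovable (false in
  reality: Lebowitz–Penrose analyticity), and a junk disproof likewise.                         → no handle
* negative-base `rpow` in `hsFreeVolume` for `η < 0` (`(η/N)^{1/3} = ½|η/N|^{1/3}`): makes `hsExcessFreeEnergy` non-
  differentiable AT `0` (left slope `−π/12` vs right `2π/3`) ⇒ `deriv … 0 = 0` junk ⇒ `Z(0) = 1` anyway; packing is
  `> 0` along solutions (`ρ, σ > 0`).                                                           → no handle (note for 0768)
* pre-pick stub audit, 12 stubs / 3 lines: no kill (`stub_audit_cycle3`).                      → none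
* literature re-sweep (2026-08-16T00:1xZ; local searchd rc 75 = degraded, remote legs up): zbMATH "self-similar
  implosion compressible" 2023+ (9 rows: CSV 2605.00808, 2606.12758, CGSS, CCSV 2606.18152, 2602.05981, 2608.10554,
  2311.09909, 2511.03033, 2410.15619 — all already in the route's search), zbMATH "imploding solutions compressible Euler
  full system" (only Guo–Hadžić–Jang–Schrecker 2509.12435 Larson–Penston stability, gravitational), arXiv leg same 8,
  OpenAlex (ICF physics only), galaxy substring "imploding solution"/"Smooth imploding"/"implosion singularit" (new:
  arXiv:2505.03091 computer-assisted stability framework for localized solutions; hal-03796687; nothing on EOS- or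
  entropy-perturbed implosion, no negative/instability result for forced untuned tracking). → none that bites
* kit toy reconsidered: the only informative computation is forced tracking IN SELF-SIMILAR VARIABLES of the BCG
  γ = 5/3 profile with a Carnahan–Starling-type `Z` (measure the exit time `s_e(σ)` vs `log(1/σ)`) — research-grade
  (profile through the sonic point, radial unstable modes excited by discretisation), and it cannot exhibit an
  infinite growth rate, so it cannot inform a DISPROOF.                                          → declined (3rd time)
-/


/-! ## §12 ✚✚✚ CYCLE 4: ENTROPY — transport, min/max principle, no cold compression, sharper compression-set budgets -/

section CycleFour

/-- **CYCLE-4 FINDINGS (gen 4, 2026-08-16).** Context: the route support `HsEosLowDensity` (stmt-0768) is PROVED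
(`Theorems/ImplosionDichotomyHsEosLowDensity.lean`, `hsEosLowDensity_proof`, p75216), so inputs I3 of §8 and the
smooth-pressure hypotheses of §10(c) are discharged in the dilute class; the lead's skeleton `Lines/log-lipschitz-budget.lean`
has 3 sorries left (`stub_typeOneImplosion`, `stub_conditionalExistence`, `stub_logBudgetShadowing` = promoted, crux-sized).

NEW NEGATIVE-SIDE STRUCTURE (all `lean check` rc 0, sorry-free, axioms propext/Classical.choice/Quot.sound; proposed as
six modules under `Theorems/PolynomialCompression/Negative/`, namespace `…Theorems.PolynomialCompressionEntropy`):

(a) `Negative/Entropy.lean` — ENTROPY TRANSPORT for the abstract law `p = ρθζ(ρ)` (`ζ` smooth on an open `J ∋ ρ`, excess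
    part `G` with `rG′ = ζ − 1`): `ent G ρ θ t y := (3/2)log θ − log ρ − G(ρ)`; `entropy_transport`:
    `∂ₜs + Σᵢ uᵢ∂ᵢs = 0` pointwise on `[0,T) × 𝕋³` (from the lead's primitive equations `hsEuler_density_eq` /
    `hsEuler_temperature_eq`, chain rules on time slices and coordinate lines, `linear_combination`);
    `timeDerivWithin_density_mul_comp_ent` (`∂ₜ(ρΦ(s)) + div(ρΦ(s)u) = 0`), `integral_density_mul_comp_ent_eq`
    (`∫ρΦ(s)(t) = ∫ρΦ(s)(0)` for every smooth `Φ`), and the ENTROPY PRINCIPLE `ent_ge_of_forall_ge` / `ent_le_of_forall_le`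
    (`min s(0,·) ≤ s(t,x) ≤ max s(0,·)`; bump `Φ = expNegInvGlue(k − ·)`, `ρ > 0`, continuous nonneg with zero integral vanishes).
    For the PROVERS: this is exactly step (D.3) of the lever (the entropy defect is transported by `u_σ`; no derivative loss).
(b) `Negative/EntropyHardSphere.lean` — the typed hard-sphere law under the UNBUNDLED EOS data `(η₀, F)`: `hs_eos_data`
    (`ζ r = hsCompressibility (rσ³)` and `G r = F(rσ³)` smooth on `(0, η₀/σ³)`, `rG′ = ζ − 1`, pressure `= ρθζ(ρ)` by `rfl`),
    `hsExcessFreeEnergy_nonneg` (free volume `≤ 1`), `hs_temperature_ge`: `θ(t,x) ≥ e^{2k/3}ρ(t,x)^{2/3}` with `k = min s(0,·)`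
    along every classical solution with packing `< η₀` (uses `F ≥ 0`), `hs_temperature_le` (the ceiling, packing `≤ η₁ < η₀`),
    `hs_isSmoothSpaceTimeOn_pressure` (smooth pressure at the SAME `η₀`, discharging `Negative/Energy.lean`'s hypothesis).
(c) `Negative/ColdCompression.lean` — ADMISSIBLE data have σ-uniform entropy bounds: `admissible_ent_zero_ge`
    (`k(profiles) = (3/2)log min θ₀ − log((2e+1)M) − 1`: data pinning §2–§4, data packing `→ 0`, `F(0) = 0`) and
    `admissible_ent_zero_le` (`K(profiles)`: `rhoLim ≥ (min β)/2` by the `O(σ³)` statics rate §3, `F ≥ 0`); hence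
    `admissible_temperature_ge` / `admissible_temperature_le`: `θ ≍ ρ^{2/3}` along EVERY admissible dilute classical solution,
    constants of the profiles only. REFUTED STRENGTHENING `PolynomialCompressionCold η₁` (the crux verbatim + packing guard
    `< η₁` + `θ ≤ Θ` at the compression point, `Θ` σ-uniform): `polynomialCompression_false_cold` — false for every EOS datum
    at radius `η₀` (at the compression point `θ ≥ cρ^{2/3} ≥ cσ^(-2κ/3) → ∞`).
(d) `Negative/CompressionSet.lean` — `admissible_volume_compressionSet_le`: `vol{σ^(-κ) ≤ ρ_t} ≤ Cσ^(5κ/3)` (internal-energy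
    budget of `Negative/Budget.lean` + `ρθ ≥ cσ^(-5κ/3)` on the set; §10(c′) made rigorous, sharper than the mass bound `σ^κ` of
    §10(b)); `admissible_mass_compressionSet_le`: `∫_{σ^(-κ) ≤ ρ_t} ρ ≤ Cσ^(2κ/3)` — only a VANISHING MASS FRACTION is compressed.
(e) `Negative/ColdCompressionEos.lean` — the same with NO hypothesis left, via `hsEosLowDensity_proof`:
    `integral_energy_eq_dilute` (energy conservation along every dilute classical solution), `admissible_temperature_ge_eos`,
    `polynomialCompression_false_cold_eos : ∃ η₀ > 0, ∀ η ≤ η₀, ¬PolynomialCompressionCold η`.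
(f) `Negative/ConstantProfiles.lean` — UNIFORM PROFILES NEVER WITNESS: `PolynomialCompressionWith κ a₀ θ₀ u₀` (the crux
    body for given exponent/profiles; `polynomialCompression_iff_with` is `Iff.rfl`) is FALSE for `(a₀, θ₀, u₀) ≡ (c, ϑ, v)` at
    every `κ > 0` (`polynomialCompressionWith_const_false[_eos]`, the `_eos` form unconditional): pinned data `(1, v, ϑ)`
    (`rhoLim_const_eq_one`), the uniform state is a solution, and EVERY classical solution with these data equals it on its
    whole interval of existence — uniqueness in the dilute class (lead, p74606) PLUS a first-exit bootstrap
    (`spaceTime_bootstrap`: continuous induction on `[0,T) × 𝕋³` for fields with continuous space–time lift; tube lemma +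
    `sInf` of bad times), which closes the "second solution escaping into the EOS-junk regime" loophole. The bootstrap lemma
    is stated reusably: it is the continuity argument of every a-priori estimate on this crux (stub 4 included).
(a′) `ideal_isentropic_of_data` (in `Negative/Entropy.lean`): at `σ = 0` (`Z(0) = 1` regardless of `deriv` junk) isentropic
    DATA stay isentropic, `θ(t) = Kρ(t)^{2/3}` — so the clause `hisen` of `stub_typeOneImplosion` / hypothesis of
    `stub_logBudgetShadowing` follows from its `t = 0` instance + `hsol₁` (information for the lead: it can be weakened).

WHAT IT MEANS FOR THE VERDICT: still RESISTS. The entropy structure is TIGHTNESS, not a kill: the intended witness (shadowing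
of the isentropic `γ = 5/3` implosion) has `θ = Kρ^{2/3}` exactly, compression-set volume `σ^{κ/(r−1)} ≪ σ^{5κ/3}` and core
mass `σ^{κ(6−3r)/(3(r−1))} ≪ σ^{2κ/3}` (`1 < r < r⋆(5/3) ≈ 1.27`), so every new necessary condition is met with room to spare.
What the cycle closes off: any witness mechanism that is (i) bulk (§10b), (ii) cold/isothermal (c), (iii) positive-mass (d),
or (iv) energetically unbounded (§10c, now unconditional). A refutation of the crux would still have to be a σ-uniform
sub-polynomial `L∞` density bound for every profile (§5), i.e. `DiluteSelfConsistency` (open). -/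
theorem cycle4_findings : True := trivial

end CycleFour

/-! ## §13 ✚✚✚ ATTACK CENSUS, cycle 4 (2026-08-16)

* 0768 now PROVED ⇒ re-audit of every "blocked on stmt-0768" line of §9/§11: the EOS-junk handles (non-differentiable
  `hsExcessFreeEnergy` on `(0, η₀)`) are now FORMALLY dead (analytic there); `Torus.gradient p` / `Torus.divergence((E+p)u)`
  are honest derivatives along dilute solutions; energy conservation unconditional (`integral_energy_eq_dilute`). → closed
* entropy transport + min/max principle (new a-priori structure, EOS-exact in the dilute class).          → tightness (landed ×5)
* cold / isothermal compression (`θ ≤ Θ` at the compression point): REFUTED (`polynomialCompression_false_cold[_eos]`). → dead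
* positive-mass compression (`∫_{ρ ≥ σ^-κ} ρ ≥ m > 0`): REFUTED in substance (mass `≤ Cσ^(2κ/3)`).              → dead
* compression-set volume: `≤ Cσ^(5κ/3)` (was `σ^κ`).                                                         → sharpened
* profile-fixed crux for UNIFORM profiles: REFUTED at every κ (uniqueness + first-exit bootstrap; `…_const_false_eos`). → dead
* `hisen` of stubs 1/4: redundant beyond `t = 0` (`ideal_isentropic_of_data`).                                → note for lead
* stub re-read after the lead's cycles 1–2 (skeleton sha at 02:18Z): stubs 1/3/4 unchanged in statement since drefute g2;
  drefute g1/g2 mutation results stand (`hrate`, `hsol₁`, `hT₁` load-bearing; `hlow` redundant; `F`-normalisations unused —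
  NOTE `F 0 = 0` IS used by (c) above, for the data entropy floor, so it is not dead weight for the negative side).
* services: gate and searchd unreachable 03:1x–03:4xZ (proposals retried later in the session; literature re-sweep of the
  cycle-2/3 degraded queries still pending — `search-degraded`, nothing held against the crux).
-/

end Summit.AtomisticToContinuum.HydrodynamicLimit.Cruxes.PolynomialCompression.Disproof

end
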